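import Mathlib
import Summits.CriticalPhenomena.SAWScalingLimit.Theses.SAWDevelopingMap
import Summits.CriticalPhenomena.SAWScalingLimit.Theses.SAWResidueField
import Summits.CriticalPhenomena.SAWScalingLimit.Theses.SAWDefectDecoherence
import Summits.CriticalPhenomena.SAWScalingLimit.Theses.SAWWindingAlias
import Summits.CriticalPhenomena.SAWScalingLimit.Theses.SAWPhaseRetrieval
import Summits.CriticalPhenomena.SAWScalingLimit.Theorems.ObservableToSLE.Negative.NoCutPoint
import Summits.CriticalPhenomena.SAWScalingLimit.Theorems.ObservableToSLE.Negative.EndpointNecessity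
import Summits.CriticalPhenomena.SAWScalingLimit.Theorems.ObservableToSLE.Negative.Identification
import Summits.CriticalPhenomena.SAWScalingLimit.Theorems.ObservableToSLE.Negative.HypothesisSilence
import Summits.CriticalPhenomena.SAWScalingLimit.Theorems.ObservableToSLE.Negative.TightnessNecessity
import Summits.CriticalPhenomena.SAWScalingLimit.Theorems.ObservableToSLE.Negative.FirstStepSilence
import Summits.CriticalPhenomena.SAWScalingLimit.Theorems.ObservableToSLE.Negative.RootSilence
import Summits.CriticalPhenomena.SAWScalingLimit.Theorems.ObservableToSLE.Negative.DeepEndpoints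
import Summits.CriticalPhenomena.SAWScalingLimit.Theorems.ObservableToSLE.Negative.HalfDiscMesh
import Summits.CriticalPhenomena.SAWScalingLimit.Theorems.ObservableToSLE.Negative.FloorClassNonVacuity
import Literature.Probability.RandomPlanarGeometry.ConformalRestrictionProofs
import Literature.Probability.RandomPlanarGeometry.CritPercSLESimplePathHolds
import Literature.Probability.RandomPlanarGeometry.CaratheodoryHalfPlaneProofs
import Literature.Probability.RandomPlanarGeometry.HullRestrictionTests
import Literature.Probability.RandomPlanarGeometry.SimpleCurves

/-!
# Disproof of `ObservableToSLE` (crux stmt-CriticalPhenomena-10472) — findings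

Standing adversary file (refuter, cdisprove; gen 6 = cycle 6, v13 — cycle-6 material is §10; cycle 5
is §9; cycle 4 is §8; gens 1–3 wrote §1–§7; rebuilt on the LANDED negative modules because evidence
copies of this file are not readable from agent jails).
Everything conclusive is LANDED under
`Summits/CriticalPhenomena/SAWScalingLimit/Theorems/ObservableToSLE/Negative/` and importable:

| module | proposal | content |
|---|---|---|
| `Negative.NoCutPoint` | p69571 ✓ | `carrier_ne_of_cutPoint`: no Dobrushin domain has a frontier with a cut point (W1, general) |
| `Negative.EndpointNecessity` | p69686 ✓ | the conclusion FORCES `IsEmbEndpointApprox`; `hexConjecture_false_without_{reachable,tendsto}` |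
| `Negative.Identification` | p69742 ✓ | `observableToSLE_iff_identification`: crux ⇔ (ObsLimit → Tight → subsequential limits are SLE(8/3) laws) |
| `Negative.HypothesisSilence` | p69852 ✓ | `flat_premise_false_on_unitDisc` (W2), `slitDisc_ne_carrier` (W1 instance), `segment_subset_frontier_of_flat` |
| `Negative.CompactContainer` | p70580 ✓ (cycle 3) | polyline Lipschitz lemma; ONE compact container for all SAW curve classes at meshes in `[lo, hi]`; Urysohn test functions |
| `Negative.TightnessNecessity` | p70660 ✓ (cycle 3) | W5: `isTightAlongMesh_of_convergesInLawToSLE`, `hexTight_of_hexConjecture`, `hexConjecture_iff_tight_and_identification`, `observableToSLE_withoutTight_iff` |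
| `Negative.FirstStepSilence` | p70837 ✓ (cycle 3) | W1 general: `slitSegment_ne_carrier` — `D ∖ [p, q]` is no Dobrushin carrier for ANY domain and ANY slit with `(p, q] ⊆ D` |
| `Negative.RootSilence` | p72155 ✓ (cycle 3) | W2 at the root (rev 4): `flat_premise_false_on_unitDisc_root`, `flat_premise_false_on_unitDisc_both` |
| `Negative.DeepEndpoints` | p72354 ✓ (cycle 3) | W2(a) typed: `exists_isEmbEndpointApprox_deep` — a legitimate endpoint approximation on `(𝔻; 1, −1)` with source at lattice depth `≥ δ^{-1/2} → ∞` |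
| `Negative.HalfDiscMesh` | p73788 ✓ (cycle 4) | the CANONICAL honeycomb mesh of the half-disc `HD` is connected (`meshHDGraph_reachable`, `embMeshDomain_HD_eq`, `hexDomainGraph_HD_reachable`) — floor-respecting descent engine |
| `Negative.FloorClassNonVacuity` | p74449 ✓ (cycle 4) | floor endpoints `aF → 1/4`, `bF → 0` of `Ω_δ(HD)`, `flat_quarter`, `floorClass_inhabited` (unfolded `IsFloorDomain ∧ IsFloorEndpointApprox`) |
| `Negative.AdmissibleInstance` | p74943 ✓ (cycle 4; not yet imported here — farm snapshot lags; re-exports follow in v12) | NON-VACUITY of the rev-4 antecedent: a checked floor-rooted instance of ALL inner hypotheses of `HexObservableLimit` on `(HD; 1/4, 0)`; `floorInstance_of_hexObservableLimit` |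
| `Negative.FloorRatioLimitRootPinning_*` | (drefute seat, 2026-08-16) | not mine — the parallel stub-refuter's proof that the root-rows clause of `FloorRatioLimit` is load-bearing (pre-rev-4 form false by the corridor witness); cited in §8 |
| `Negative.ModulusNecessity` | cycle 6 (proposal pending at the gate; checked rc 0, axioms standard; local copies in §10.1) | W6: the UNIFORM INJECTIVITY MODULUS isolated by the landed stub-5 reduction is NECESSARY — `uniformModulus_of_convergesInLawToSLE` (κ ≤ 4), `uniformModulus_of_hexConjecture`, `floorUniformModulus_of_hexConjecture` (verbatim 1st hypothesis of `FloorRatio.stub_chordalCarrier_ofModulus`); and so is the sibling vertex typing: `noRetrace_of_hexConjecture` (verbatim hypothesis of `FloorRatio.stub_chordalCarrier_noRetrace`), via `polyline_cons_apply_prefixTime` (vertex `k` at dyadic time `1 − 2^{-k}`) |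
| `Negative.ChordalCarrier` | p76405 ✓ (cycle 5, commit c8144c2a0510) | stub 5: `ae_mem_chordalCarrier_of_isSLELaw` (κ ≤ 4), `chordalCarrier_of_hexConjecture` (stub-5 conclusion ⇐ Conj.1); NATURAL STRENGTHENING REFUTED: `not_mem_chordalCarrier_of_rangeData`, `exists_dirac_same_rangeData` (carrier membership is not a function of range data: back-tracking `γ ∘ zigzag`) |

## Verdict so far (cycles 1–6): NO KILL, and why it resists

`¬ ObservableToSLE ↔ HexObservableLimit ∧ HexTight ∧ ¬ HexConjecture` (`not_crux_iff`): a refutation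
must PROVE DCS Conjecture 2 (ψ-averaged, flat-at-`b` form) and eventual tightness of the critical
hexagonal SAW, and DISPROVE DCS Conjecture 1 as typed.  The typed conclusion is not junk-refutable:
it forces exactly its own hypothesis structure (`isEmbEndpointApprox_of_convergesInLawToSLE`), the
Dobrushin domain is a genuine Jordan domain with distinct marked points, mesh edges are kept only
when the closed segment lies in `closure Ω` (no fjord jumping), `Ω_δ` is DCS's largest component,
and `CurveClass ℂ` is Polish.  Hence the crux is implied by its own conclusion (`of_conclusion`)
and no `_false_without_<H>` theorem exists for either hypothesis (`without*_of_hexConjecture`).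

## Obstruction index for PROVERS (W1–W5; W1–W4 from the crux attack, typed in cycles 1–2)

* W1 `HexObservableLimit` quantifies `∀ D : DobrushinDomain` (Jordan): it is SILENT on every slit
  domain `Ω ∖ γ[0,t]` of the martingale scheme (`carrier_ne_of_cutPoint`, `slitDisc_ne_carrier`),
  already after ONE step in EVERY domain (`slitSegment_ne_carrier`, cycle 3).
* W2 its flat-at-`b` premise (H2) holds only for horizontal floors with the domain above
  (`segment_subset_frontier_of_flat`) and FAILS on the unit disc for every radius
  (`flat_premise_false_on_unitDisc`), while the conclusion quantifies over the disc and over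
  interior endpoint approximations: an endpoint-universality / boundary-perturbation transfer is
  an unfiled part of every line (all five crux idea cards leave W2 as a named residual); W2(a):
  the endpoint class includes sources `δ^{-1/2}` lattice units deep (`exists_isEmbEndpointApprox_deep`,
  cycle 3), and since rev 4 the hypothesis is pinned at BOTH marked points (`Negative.RootSilence`).
* W3 `IsTightAlongMesh` in `CurveClass ℂ` gives no Loewner regularity of subsequential limits.
* W4 the Itô arithmetic of the mechanism is right: drift of `g′^α (g − W)^β` vanishes iff
  `κ = 4(α−β)/(β(β−1))`; `(5/8, −5/4) ↦ 8/3` (`itoDrift_eq_zero_iff`, this file §4).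
* W5 (cycle 3, LANDED) `HexTight` is NOT a removable technicality: `HexConjecture → HexTight`
  (`hexTight_of_hexConjecture`), so `HexConjecture ↔ HexTight ∧ Identification`
  (`hexConjecture_iff_tight_and_identification`) and the crux with `HexTight` discharged is
  `HexObservableLimit → HexTight ∧ Identification` (`observableToSLE_withoutTight_iff`): any line
  that avoids the tightness hypothesis proves tightness on the way; conversely a refutation of
  item `HexTight` (stmt-5423) refutes `HexConjecture` (stmt-0808) and every hexagonal route
  (`not_hexConjecture_of_not_hexTight`).  For the restriction-type crux ideas: identification of
  the RANGE law via LSW uniqueness still needs tightness in `CurveClass ℂ` of the curve laws —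
  `HexTight` is exactly that and cannot be weakened to tightness of ranges/hulls if the typed
  conclusion (convergence in `CurveClass ℂ`) is the goal.
* W6 (cycle 6, §10.1) the UNIFORM INJECTIVITY MODULUS (UIM) — the one lattice estimate modulo which
  the line landed its simplicity stub (`FloorRatio.stub_chordalCarrier_ofModulus`) — is, like
  tightness, a CONSEQUENCE of the conclusion: `HexConjecture → UIM` for every Dobrushin domain and
  endpoint approximation (`uniformModulus_of_hexConjecture`).  So UIM is not refutable short of
  `¬HexConjecture`, every proof of the crux re-proves it, and the sibling typing `NoRetrace`
  (which implies UIM, `FloorRatio.uniformModulus_of_noRetrace`) sits in the same class.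

Prose lives only in docstrings; every `theorem` below is checked (rc 0, no `sorry` unless in the
`NearMisses` section, currently empty).  Targets section §6: line PICKED (floor-ratio-restriction-
bootstrap), 7 registered stubs audited (cycles 3, 4, 5), 0 broken, stub 1 landed, no stuck stubs;
cycle 5 (§9): T7 dimensional attack closed (consistent), stub 5 decomposed (5a provable from its own
hypothesis, 5b set-level LSW, 5c = the open no-backtracking core; first-moment arm counting cannot
work), stub 2 ⇐ half-plane arch convergence by a monotone interchange, W2 not reachable by
Carathéodory approximation inside the floor class; cycle 6 (§10): W6 (UIM necessity, checked), the
rev-4 antecedent re-audited for branch / dilation / mesoscopic-lift / collar levers (all consistent,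
checked invariance lemma), deep starts versus radial restriction exponents (consistent), the anchor
versus Conj. 1 on bounded domains (NOT implied: escape-to-infinity scenario absorbs every bound),
Kennedy–Lawler lattice corrections depend only on the boundary angle (consistent with the rigid
flat class), Kennedy's half-plane tests of SLE(8/3) to 0.05 %.
-/

noncomputable section

open Literature.Probability.RandomPlanarGeometry Literature.Probability.RandomPlanarGeometry.SAW
  Literature.Probability.LatticeModels Literature.Probability MeasureTheory Filter Topology Set
open scoped NNReal ENNReal

namespace Summit.CriticalPhenomena.SAWScalingLimit.Cruxes.ObservableToSLE.Disproof

open Summit.CriticalPhenomena.SAWScalingLimit.Theses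
open Summit.CriticalPhenomena.SAWScalingLimit.Theorems.ObservableToSLE.Negative

/-! ## §1 Logical shape of the crux -/

/-- The crux is literally `HexObservableLimit → HexTight → HexConjecture`. -/
theorem crux_iff :
    SAWDevelopingMap.ObservableToSLE ↔
      (SAWDevelopingMap.HexObservableLimit → SAWDevelopingMap.HexTight →
        SAWDevelopingMap.HexConjecture) :=
  Iff.rfl

/-- The crux is implied by its own conclusion (DCS Conjecture 1 as typed). -/
theorem of_conclusion (h : SAWDevelopingMap.HexConjecture) : SAWDevelopingMap.ObservableToSLE :=
  fun _ _ => h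

/-- What a refutation would have to deliver: both open antecedents AND the negation of DCS
Conjecture 1. -/
theorem not_crux_iff :
    ¬ SAWDevelopingMap.ObservableToSLE ↔
      SAWDevelopingMap.HexObservableLimit ∧ SAWDevelopingMap.HexTight ∧
        ¬ SAWDevelopingMap.HexConjecture := by
  constructor
  · intro h
    by_contra hc
    apply h
    intro hO hT
    by_contra hC
    exact hc ⟨hO, hT, hC⟩
  · rintro ⟨hO, hT, hC⟩ h
    exact hC (h hO hT)

/-! ### Rev 4 of the route files (2026-08-16T00:03:57Z): the ANTECEDENT was repaired

The pre-rev-4 antecedent `HexObservableLimit` (item stmt-5420: root `a_δ` tied to `pt 0` only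
Euclideanly) was REFUTED (refuted-misstated, corridor witness:
`Summit.CriticalPhenomena.SAWScalingLimit.Theorems.SAWDefectDecoherenceHexObservableLimit_refuted`
@ b90fe791a4c9, by the cdisprove seat of stmt-8536), which made the pre-rev-4 crux VACUOUSLY
provable.  The planners restated the target IN PLACE: `SAWDevelopingMap.HexObservableLimit` is now
the repaired item stmt-14003 (root pinned conformally: flat horizontal pieces and exact half-lattice
discretisation at BOTH marked points, `m : Fin 2 → ℝ → ℤ`), and this crux (stmt-10472, text
unchanged) now MEANS `HexObservableLimit[rev 4] → HexTight → HexConjecture`; the sibling routes carry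
the same statement as `ObservableToSLER` (item stmt-14005) over `HexObservableLimitR` — all
`Iff.rfl`-identical (below), so stmt-10472 ≡ stmt-14005 as statements.  Consequences recorded in §6:
every landed Negative lemma is stated over the `SAWDevelopingMap` names and holds verbatim; W2 is
STRENGTHENED (the hypothesis is now silent at every non-flat ROOT as well, `flat_premise_false_on_unitDisc_both`,
`Negative.RootSilence`); the "rough source" reversal lever (card reversed-tip-terminal-harnack) has no
hypothesis left to consume. -/

/-- The route copies of the crux are syntactically one statement (rev 4 names). -/
theorem residueField_iff :
    SAWResidueField.ObservableToSLER ↔ SAWDevelopingMap.ObservableToSLE := Iff.rfl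

theorem defectDecoherence_iff :
    SAWDefectDecoherence.ObservableToSLER ↔ SAWDevelopingMap.ObservableToSLE := Iff.rfl

theorem windingAlias_iff :
    SAWWindingAlias.ObservableToSLE ↔ SAWDevelopingMap.ObservableToSLE := Iff.rfl

theorem phaseRetrieval_iff :
    SAWPhaseRetrieval.ObservableToSLER ↔ SAWDevelopingMap.ObservableToSLE := Iff.rfl

/-- The repaired antecedents agree across the routes (item stmt-14003). -/
theorem obsLimitR_iff :
    SAWResidueField.HexObservableLimitR ↔ SAWDevelopingMap.HexObservableLimit := Iff.rfl

example : SAWDefectDecoherence.HexObservableLimitR ↔ SAWDevelopingMap.HexObservableLimit := Iff.rfl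
example : SAWWindingAlias.HexObservableLimitR ↔ SAWDevelopingMap.HexObservableLimit := Iff.rfl
example : SAWPhaseRetrieval.HexObservableLimitR ↔ SAWDevelopingMap.HexObservableLimit := Iff.rfl

/-! W2 at the ROOT (rev 4; LANDED as `Negative.RootSilence`, p72155 ✓ — imported since v10, re-exported
in §8.0):
`flat_premise_false_on_unitDisc_both (ρ) (hρ : 0 < ρ) (i : Fin 2) :
  𝔻.carrier ∩ ball (𝔻.pt i) ρ ≠ {z | (𝔻.pt i).im < z.im} ∩ ball (𝔻.pt i) ρ` — the two-point flat
premise of the repaired hypothesis fails on the unit disc at each marked point, for every radius. -/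

/-! ### Load-bearing analysis: the crux with a hypothesis dropped

Both weakenings are implied by `HexConjecture`, so NO theorem `observableToSLE_false_without_<H>`
can be proved without refuting DCS Conjecture 1 itself; the hypotheses are decoration
truth-wise and load-bearing only proof-wise. -/

/-- The crux with `HexObservableLimit` dropped. -/
def ObservableToSLEWithoutObsLimit : Prop :=
  SAWDevelopingMap.HexTight → SAWDevelopingMap.HexConjecture

/-- The crux with `HexTight` dropped. -/
def ObservableToSLEWithoutTight : Prop :=
  SAWDevelopingMap.HexObservableLimit → SAWDevelopingMap.HexConjecture

/-- The crux with both hypotheses dropped is DCS Conjecture 1. -/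
def ObservableToSLEWithoutHyps : Prop :=
  SAWDevelopingMap.HexConjecture

theorem withoutObsLimit_of_hexConjecture (h : SAWDevelopingMap.HexConjecture) :
    ObservableToSLEWithoutObsLimit := fun _ => h

theorem withoutTight_of_hexConjecture (h : SAWDevelopingMap.HexConjecture) :
    ObservableToSLEWithoutTight := fun _ => h

theorem crux_of_withoutObsLimit (h : ObservableToSLEWithoutObsLimit) :
    SAWDevelopingMap.ObservableToSLE := fun _ hT => h hT

theorem crux_of_withoutTight (h : ObservableToSLEWithoutTight) :
    SAWDevelopingMap.ObservableToSLE := fun hO _ => h hO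

theorem withoutHyps_iff : ObservableToSLEWithoutHyps ↔ SAWDevelopingMap.HexConjecture := Iff.rfl

/-! ## §2 The conclusion is tightly typed (LANDED: `Negative.EndpointNecessity`)

`ConvergesInLawToSLE κ D curve hexSAWLaw → IsEmbEndpointApprox hexGraph hexCenter D a b`
(`isEmbEndpointApprox_of_convergesInLawToSLE`); hence `HexConjecture ↔ ∀ D a b,
(IsEmbEndpointApprox ↔ ConvergesInLawToSLE (8/3) …)`, and the conclusion with `reachable`, resp.
the two `tendsto` fields, dropped is FALSE.  Re-exported here as usage examples. -/

example : ¬ ∀ (D : DobrushinDomain) (a b : ℝ → HexVertex),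
    (∀ᶠ δ in 𝓝[>] (0 : ℝ), (hexDomainGraph D.carrier δ).Reachable (a δ) (b δ)) →
      ConvergesInLawToSLE ((8 : ℝ≥0) / 3) D
        (fun δ (γ : HexDomainSAW D.carrier δ (a δ) (b δ)) => γ.curve)
        (fun δ => hexSAWLaw D.carrier δ (a δ) (b δ)) :=
  hexConjecture_false_without_tendsto

example : ¬ ∀ (D : DobrushinDomain) (a b : ℝ → HexVertex),
    Tendsto (fun δ : ℝ => (δ : ℂ) * hexCenter (a δ)) (𝓝[>] (0 : ℝ)) (𝓝 (D.pt 0)) →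
    Tendsto (fun δ : ℝ => (δ : ℂ) * hexCenter (b δ)) (𝓝[>] (0 : ℝ)) (𝓝 (D.pt 1)) →
      ConvergesInLawToSLE ((8 : ℝ≥0) / 3) D
        (fun δ (γ : HexDomainSAW D.carrier δ (a δ) (b δ)) => γ.curve)
        (fun δ => hexSAWLaw D.carrier δ (a δ) (b δ)) :=
  hexConjecture_false_without_reachable

example : SAWDevelopingMap.HexConjecture ↔ ∀ (D : DobrushinDomain) (a b : ℝ → HexVertex),
    (IsEmbEndpointApprox hexGraph hexCenter D a b ↔
      ConvergesInLawToSLE ((8 : ℝ≥0) / 3) D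
        (fun δ (γ : HexDomainSAW D.carrier δ (a δ) (b δ)) => γ.curve)
        (fun δ => hexSAWLaw D.carrier δ (a δ) (b δ))) :=
  hexConjecture_iff_endpoint_characterisation

/-! ## §3 The crux is exactly identification (LANDED: `Negative.Identification`) -/

example : SAWDevelopingMap.ObservableToSLE ↔
    (SAWDevelopingMap.HexObservableLimit → SAWDevelopingMap.HexTight →
      ∀ (D : DobrushinDomain) (a b : ℝ → HexVertex),
        IsEmbEndpointApprox hexGraph hexCenter D a b →
          ∀ μ : Measure (CurveClass ℂ), IsProbabilityMeasure μ →
            IsSubseqLimitLaw (fun δ (γ : HexDomainSAW D.carrier δ (a δ) (b δ)) => γ.curve)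
              (fun δ => hexSAWLaw D.carrier δ (a δ) (b δ)) μ →
              IsSLELaw ((8 : ℝ≥0) / 3) D μ) :=
  observableToSLE_iff_identification

/-! ## §4 Hypothesis silence (LANDED: `Negative.HypothesisSilence`, `Negative.NoCutPoint`) and
the Itô check of the mechanism (W4, re-derived here) -/

example (D : DobrushinDomain) :
    D.carrier ≠ Metric.ball (0 : ℂ) 1 \ {z : ℂ | z.im = 0 ∧ 0 ≤ z.re} :=
  slitDisc_ne_carrier D

example (ρ : ℝ) (hρ : 0 < ρ) :
    DobrushinDomain.unitDisc.carrier ∩ Metric.ball (DobrushinDomain.unitDisc.pt 1) ρ ≠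
      {z : ℂ | (DobrushinDomain.unitDisc.pt 1).im < z.im} ∩
        Metric.ball (DobrushinDomain.unitDisc.pt 1) ρ :=
  flat_premise_false_on_unitDisc ρ hρ

/-- W4. The Itô drift coefficient (per `dt`, divided by `g′^α (g−W)^{β−2}`) of
`M_t = g_t′(z)^α (g_t(z) − W_t)^β` under Loewner's equation `∂_t g = 2/(g − W)`, `W = √κ B`:
`−2α + 2β + κ β(β−1)/2`. -/
def itoDrift (α β κ : ℝ) : ℝ := -2 * α + 2 * β + κ * β * (β - 1) / 2

/-- With the parafermionic data `(α, β) = (5/8, −5/4)` (boundary weight 5/8 at `b ↦ ∞`, i.e.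
`(g′)^{5/8} (g − W)^{−2·5/8}`), the observable is a local martingale iff `κ = 8/3`. -/
theorem itoDrift_eq_zero_iff (κ : ℝ) : itoDrift (5 / 8) (-5 / 4) κ = 0 ↔ κ = 8 / 3 := by
  unfold itoDrift
  constructor <;> intro h <;> linarith

/-- The general family: for `β(β−1) ≠ 0` the drift vanishes iff `κ = 4(α − β)/(β(β − 1))`. -/
theorem itoDrift_family {α β : ℝ} (hβ : β * (β - 1) ≠ 0) (κ : ℝ) :
    itoDrift α β κ = 0 ↔ κ = 4 * (α - β) / (β * (β - 1)) := by
  unfold itoDrift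
  rw [eq_div_iff hβ]
  constructor <;> intro h <;> linarith

/-! ## §5 Cycle 3 (LANDED): tightness is NECESSARY (W5) and first-step silence (W1 general) -/

/-- W5, pointwise and for every `κ`: convergence in law of the critical hexagonal SAW FORCES
tightness along the mesh (re-export of `Negative.TightnessNecessity`). -/
example {κ : ℝ≥0} {D : DobrushinDomain} {a b : ℝ → HexVertex}
    (h : ConvergesInLawToSLE κ D (fun δ (γ : HexDomainSAW D.carrier δ (a δ) (b δ)) => γ.curve)
      (fun δ => hexSAWLaw D.carrier δ (a δ) (b δ))) :
    IsTightAlongMesh (fun δ (γ : HexDomainSAW D.carrier δ (a δ) (b δ)) => γ.curve)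
      (fun δ => hexSAWLaw D.carrier δ (a δ) (b δ)) :=
  isTightAlongMesh_of_convergesInLawToSLE h

/-- W5 at item level: `HexConjecture → HexTight`. -/
example : SAWDevelopingMap.HexConjecture → SAWDevelopingMap.HexTight := hexTight_of_hexConjecture

/-- W5, structure of the target: `HexConjecture ↔ HexTight ∧ Identification`. -/
example : SAWDevelopingMap.HexConjecture ↔
    SAWDevelopingMap.HexTight ∧
      ∀ (D : DobrushinDomain) (a b : ℝ → HexVertex),
        IsEmbEndpointApprox hexGraph hexCenter D a b →
          ∀ μ : Measure (CurveClass ℂ), IsProbabilityMeasure μ →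
            IsSubseqLimitLaw (fun δ (γ : HexDomainSAW D.carrier δ (a δ) (b δ)) => γ.curve)
              (fun δ => hexSAWLaw D.carrier δ (a δ) (b δ)) μ →
              IsSLELaw ((8 : ℝ≥0) / 3) D μ :=
  hexConjecture_iff_tight_and_identification

/-- The two `Without` weakenings of §1 are therefore EQUIVALENT given W5: dropping `HexTight` from
the crux costs nothing logically beyond `HexObservableLimit → HexTight`. -/
theorem withoutTight_iff_obsLimit_imp_tight_and_withoutObsLimit :
    ObservableToSLEWithoutTight ↔
      ((SAWDevelopingMap.HexObservableLimit → SAWDevelopingMap.HexTight) ∧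
        SAWDevelopingMap.ObservableToSLE) := by
  constructor
  · intro h
    exact ⟨fun hO => hexTight_of_hexConjecture (h hO), fun hO _ => h hO⟩
  · rintro ⟨hT, hc⟩ hO
    exact hc hO (hT hO)

/-- W1 for every domain (re-export of `Negative.FirstStepSilence`): after one exploration step
along any segment `[p, q]` with `(p, q] ⊆ D`, the slit domain is no Dobrushin carrier. -/
example (D D' : DobrushinDomain) {p q : ℂ} (hpq : p ≠ q)
    (hseg : ∀ t ∈ Set.Ioc (0 : ℝ) 1, p + (t : ℂ) * (q - p) ∈ D.carrier) :
    D'.carrier ≠ D.carrier \ segment ℝ p q :=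
  slitSegment_ne_carrier D D' hpq hseg

/-! ## §6 TARGETS — line PICKED 2026-08-16T00:28Z: `floor-ratio-restriction-bootstrap` (lead reshape 00:38Z,
rev-4 `FloorRatioLimit` with root clauses; 7 registered stubs; no STUCK stubs reported yet)

Cheap-arsenal verdict on the 7 registered stubs (cycle 3; 0 broken):
`stub_targetTransport` SURVIVES and is provable (rev-4 form: the reshaped `FloorRatioLimit` carries
flatness + exact rows at `pt 0`; degenerate audit: `D' = D` forces `F(b'_δ)/F(b_δ) → 1` for two
mid-edge sequences at one point — implied by two instances of the hypothesis, SLE-consistent;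
overlapping balls with unequal row functions or floors at different heights make the premises
unsatisfiable, i.e. vacuous instances, not falsity; the boundary value `Φ(b') ∈ ℝ` exists since
interior limit values would pull back into `D`).  `stub_shortChordLocality` SURVIVES (anchor, open;
see the classification below).  `stub_restrictionCocycle`, `stub_canonicalTransfer` SURVIVE
(mechanism/glue; conclusions implied by Conj.1 + LSW).  `stub_chordalCarrier` SURVIVES (implied by
Conj.1; simplicity half OPEN-PROBLEM strength).  `stub_restrictionIdentifies` SURVIVES (tree glue;
conclusion implied by Conj.1, `identification_of_hexConjecture`).  `stub_domainExtension` (held by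
the lead) ≡ the crux given stubs 1–6 (`extension_iff_crux_of_floor`) and must cover DEEP starts
(`exists_isEmbEndpointApprox_deep`, `Negative.DeepEndpoints`) and non-flat marked points at BOTH ends
(`Negative.RootSilence`): recommend PROMOTE to a route item (endpoint/boundary universality) unless
a transfer mechanism is named — no instance of the hypothesis reaches it.

(The text below is the pre-pick preview, still accurate for all three skeletons.)

Three crux-plan skeletons exist under `Cruxes/ObservableToSLE/Lines/` (floor-ratio-restriction-
bootstrap, coalescent-arc-restriction, source-residue-restriction-pinning); all share one lever
(two instances of `HexObservableLimit` with the normalisation point re-marked on the same floor ⇒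
target transport `Z_δ(a→b′)/Z_δ(a→b) → |Φ′(b′)/Φ′(b)|^{5/8}`; exact lattice restriction; LSW 5/8
uniqueness).  Cheap-attack classification of their stubs (cycle 3; details in the evidence notes):

* IMPLIED BY `HexConjecture` (hence NOT refutable short of ¬Conj.1, like the crux itself): every
  identification-type stub — `RestrictionIdentifies`, `FloorIdentification → FullIdentification`
  (`DomainExtension` / `stub_extension` / `stub_domainEndpointUniversality`), `ChordalCarrierOfLimits`
  modulo the tree fact that SLE(8/3) laws charge the chordal carrier, `NoRetrace` (the near-return
  event is closed in `CurveClass ℂ` and null for a.s. simple limits), and the restriction-limit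
  statements (`AdmissibleRestrictionLimit`, `FloorRestrictionLimit`, `RestrictionCocycleLimit`)
  modulo LSW's formula for SLE(8/3) + portmanteau.  See `identification_of_hexConjecture` below for
  the common core, checked.
* GENUINELY EXTRA (uniform lattice estimates NOT implied by Conj.1 on bounded Jordan domains, the
  only stubs a disprover could in principle kill while Conj.1 stands): the anchors
  `ShortChordLocality` / `ArcLocality` / `farExitMassBound` — half-plane arch locality uniformly in
  the span.  Degenerate-instance audit: `K`/`R` are existential after `ε`, `n ≥ 1`, `m ≠ 0`, so the
  small-span cases reduce to tail convergence of DCS's arch series (Lemma 2, tree) and are TRUE;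
  non-floor boundary mid-edges `s` admitted by the typing (slanted pendant edges when `Λ` omits the
  `k = 0` vertices of its bottom row) reduce to the floor case.  No finite computation refutes a
  `K → ∞` statement; the triage kit jobs (transfer-matrix arches to `R ≈ 6`) are consistent.  These
  stubs SURVIVE the cheap arsenal; they are SLE-consistent (boundary two-leg exponent 2).
* PROVABLE NOW (bookkeeping): `TargetTransport` (two instances of the hypothesis; `Φ − x₀` is again a
  `ConformalEquiv` onto `ℍ` with the same `L`; a bump `ψ = conj(e^{(5/8)L})·χ` makes the limit
  nonzero), `Coalescence`, `CanonicalTransfer`-type discretisation glue.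
* THE RESIDUE every line isolates is W2 (`DomainExtension` / `stub_extension` /
  `stub_domainEndpointUniversality`): given the other stubs it is logically the crux restricted off
  the floor class (`extension_iff_crux_of_floor`, checked below in abstract form); `HexObservableLimit`
  is silent there (`flat_premise_false_on_unitDisc`), so W2 needs a transfer mechanism of its own
  (boundary perturbation / endpoint universality), for which no line has a tool yet.
* REV 4 EFFECT on the three skeletons (all typed before 00:03Z against the pre-rev-4 hypothesis):
  their `TargetTransport` stubs consume `HexObservableLimit`; after the repair an instance needs the
  ROOT on a horizontal floor with exact half-lattice rows too.  Floor domains (`IsFloorDomain`,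
  `FlatOnLine`: both marked points on one floor) satisfy this, so the floor-ratio / coalescent-arc /
  source-residue lines survive with their base class intact; but every use of the hypothesis with a
  rough, cornered or slit-tip SOURCE (the reversal lever of card reversed-tip-terminal-harnack;
  "ANY boundary source" in `stub_extension`'s handles) is now OUTSIDE the hypothesis class.
* W5 for these lines: none of them uses `HexTight` before the extension stub; by
  `observableToSLE_withoutTight_iff` whatever they prove without it re-proves tightness — harmless,
  but identification of the RANGE law (LSW) becomes identification of the CURVE law only on simple
  carriers, which is why each line carries a simplicity stub (`stub_chordalCarrier`, `NoRetrace`):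
  that stub is implied by Conj.1 but is OPEN-PROBLEM strength on the lattice (no tool in print
  gives simplicity of SAW subsequential limits; KS17 Condition G is unknown for SAW).
-/

/-- Common core of the identification-type stubs: `HexConjecture` alone gives identification of
every subsequential limit law, for every Dobrushin domain and endpoint approximation (so
`FullIdentification`, `Identification`, `RestrictionIdentifies`' conclusion, … are consequences of
DCS Conjecture 1 and cannot be refuted independently of it). -/
theorem identification_of_hexConjecture (h : SAWDevelopingMap.HexConjecture)
    (D : DobrushinDomain) (a b : ℝ → HexVertex) (hab : IsEmbEndpointApprox hexGraph hexCenter D a b)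
    (μ : Measure (CurveClass ℂ)) (hμ : IsProbabilityMeasure μ)
    (hsub : IsSubseqLimitLaw (fun δ (γ : HexDomainSAW D.carrier δ (a δ) (b δ)) => γ.curve)
      (fun δ => hexSAWLaw D.carrier δ (a δ) (b δ)) μ) :
    IsSLELaw ((8 : ℝ≥0) / 3) D μ :=
  (hexConjecture_iff_tight_and_identification.1 h).2 D a b hab μ hμ hsub

/-! W2(a) TYPED (LANDED as `Negative.DeepEndpoints`, p72354 ✓ — imported since v10, re-exported in §8.0):
`exists_isEmbEndpointApprox_deep : ∃ a b, IsEmbEndpointApprox hexGraph hexCenter 𝔻 a b ∧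
  Tendsto (fun δ => infDist (δ·a_δ) (ball 0 1)ᶜ / δ) (𝓝[>] 0) atTop` — the conclusion's quantifier
includes sources started `δ^{-1/2}` lattice units deep inside the domain, joined to `b_δ` in `Ω_δ`;
every extension stub must produce chordal SLE(8/3) for such deep starts, about which no instance of
the boundary-mid-edge / floor-vertex hypothesis speaks. -/

/-- Abstract shape of the three skeletons: stubs deliver `HexObservableLimit → FloorId` (floor-class
identification) and an extension stub `HexObservableLimit → HexTight → FloorId → FullId`, composed
through `observableToSLE_iff_identification`.  GIVEN the floor-class stubs, the extension stub is
EQUIVALENT to the crux: it is the crux restricted off the floor class, with the floor-class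
identification as its only new premise. -/
theorem extension_iff_crux_of_floor {FloorId : Prop}
    (hfloor : SAWDevelopingMap.HexObservableLimit → FloorId) :
    (SAWDevelopingMap.HexObservableLimit → SAWDevelopingMap.HexTight → FloorId →
        ∀ (D : DobrushinDomain) (a b : ℝ → HexVertex),
          IsEmbEndpointApprox hexGraph hexCenter D a b →
            ∀ μ : Measure (CurveClass ℂ), IsProbabilityMeasure μ →
              IsSubseqLimitLaw (fun δ (γ : HexDomainSAW D.carrier δ (a δ) (b δ)) => γ.curve)
                (fun δ => hexSAWLaw D.carrier δ (a δ) (b δ)) μ →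
                IsSLELaw ((8 : ℝ≥0) / 3) D μ) ↔
      SAWDevelopingMap.ObservableToSLE := by
  rw [observableToSLE_iff_identification]
  constructor
  · intro h hO hT
    exact h hO hT (hfloor hO)
  · intro h hO hT _
    exact h hO hT

/-! ## §8 Cycle 4 (gen 4, 2026-08-16): second-opinion audit of the RESHAPED skeleton, the exact
prediction for the anchor, the exact-identity classification of the rev-4 antecedent (why no second
junk refutation), and NON-VACUITY of its hypothesis class (LANDED: `Negative.AdmissibleInstance`)

### §8.0 Re-exports of the cycle-3 modules now importable here -/

/-- W2 at both marked points (`Negative.RootSilence`). -/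
example (ρ : ℝ) (hρ : 0 < ρ) (i : Fin 2) :
    DobrushinDomain.unitDisc.carrier ∩ Metric.ball (DobrushinDomain.unitDisc.pt i) ρ ≠
      {z : ℂ | (DobrushinDomain.unitDisc.pt i).im < z.im} ∩ Metric.ball (DobrushinDomain.unitDisc.pt i) ρ :=
  flat_premise_false_on_unitDisc_both ρ hρ i

/-- W2(a): deep sources are legitimate endpoint approximations (`Negative.DeepEndpoints`). -/
example : ∃ a b : ℝ → HexVertex, IsEmbEndpointApprox hexGraph hexCenter DobrushinDomain.unitDisc a b ∧
    Tendsto (fun δ : ℝ => Metric.infDist ((δ : ℂ) * hexCenter (a δ)) (Metric.ball (0 : ℂ) 1)ᶜ / δ)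
      (𝓝[>] (0 : ℝ)) atTop :=
  exists_isEmbEndpointApprox_deep

/-! ### §8.1 Second-opinion audit of the 7 registered stubs as RESHAPED by the lead (rev-4
`FloorRatioLimit`, file `Lines/floor-ratio-restriction-bootstrap.lean` @ 2026-08-16T00:38Z) — verdict
unchanged: 0 broken; details the cycle-3 §6 did not spell out

* `stub_targetTransport` — LANDED meanwhile by the line worker (`Theorems/SAWDevelopingMapObservableToSLETargetTransport.lean`,
  sorry-free, 2026-08-16T01:01Z), confirming the cycle-3 verdict "provable".  Clause by clause: instance 1 = `(D, ρ, Λ, ![m₀,m], a, b, Φ, L, Lb, ψ)`,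
  instance 2 = `(D', ρ, Λ, ![m₀,m'], a, b', Φ − x₀, L, Lb', ψ)`; `x₀ := lim_{z→b'} Φ z` EXISTS (on the
  convex half-disc `D ∩ B(b', ρ)` the derivative `Φ' = e^L` is bounded since `L → Lb'`, so `Φ` is
  Lipschitz there, hence Cauchy at `b'`) and is REAL (a limit value in `ℍ` would pull `b' ∈ ∂D` into `D`
  through the homeomorphism `Φ⁻¹`; values lie in `closure ℍ`); `Φ − x₀ : D ≃ ℍ` conformal, same `L`,
  `‖Φ − x₀‖ → ∞` at `a`, boundary value `0` at `b'`; `F_δ(b_δ), F_δ(b'_δ), δ²ΣψF ≠ 0` eventually because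
  the two limits are nonzero for a bump with `∫ψ e^{(5/8)L} ≠ 0`; divide.  The drefute seat has meanwhile
  LANDED that the root-rows clause added by the reshape is load-bearing
  (`Negative.FloorRatioLimitRootPinning_{Lattice,HalfDisc}`: the pre-rev-4 form is false by the corridor
  witness), confirming the lead's PICKED.md diagnosis.
* `stub_restrictionCocycle` (mechanism; provable from stubs 1–2 modulo boundary-derivative bookkeeping).
  The algebra checks: with `Φ_D = J ∘ φ⁻¹`, `Φ_{D'} = J ∘ Φ_A ∘ φ⁻¹`, `J w = −1/w`, one has
  `Φ_{D'}'/Φ_D' = Φ_A'(w) w²/Φ_A(w)²`, which `→ 1` at `w → ∞` (`Φ_A(w)/w → 1`, `IsRestrictionMap`) and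
  `→ d·d⁻² = 1/d` at `w → 0` (`Φ_A(w)/w → d`, `HasRestrictionDeriv`); hence
  `R(s) = |Φ_{D'}'(b)/Φ_D'(b)|^{5/8}·|Φ_D'(s)/Φ_{D'}'(s)|^{5/8} → 1·(1/(1/d))^{5/8} = d^{5/8}` as `s → a` ✓
  (the tree's normalisation of `Φ_A` — boundary value `0` at `0` AND `Φ(z)/z → 1` at `∞` — is exactly
  what makes `d = Φ_A'(0)` well defined; a scaling `λΦ_A` is excluded, so the conclusion `→ d^{5/8}`
  is not two-valued).  `|F_δ(p)| = Z_δ(a → p)` at floor exits: the winding of every simple lattice path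
  from the floor edge `a` to a floor edge `p` inside a simply connected `Λ` above the floor is `∓π`
  (discrete Umlaufsatz), so the phase is deterministic ✓.
* `stub_shortChordLocality` (anchor, OPEN).  (i) The clause `(hexMidpoint t).im = (hexMidpoint s).im`
  is REDUNDANT given the others once `K ≥ 1`: inside `B(mid s, 2Kn)` the set `Λ` is the exact
  half-lattice above the line through `mid s`, whose boundary mid-edges are all of one type (vertical
  floor edges if `s` is vertical, the two slanted pendant edges per bottom vertex if `s` is slanted) and
  all at the height of `mid s`; `t` lies in that ball.  (Information for the prover: nothing to
  discharge there.)  (ii) EQUIVALENT, up to `ε ↔ ε/(1−ε)`, to pure half-plane arch tightness: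
  numerator `≤` the half-plane far-arch mass (monotonicity, `Λ ⊆` half-plane), denominator `≥` the
  half-box mass; conversely apply the stub to `Λ = H_R` (half-discs, `R → ∞`).  Both sides are FINITE:
  the total half-plane arch mass from `s` is `≤ 1/cos(3π/8)` (DCS Lemma 2, tree; transported to the stub's
  `HexMidEdgeSAW` vocabulary by the anchor worker, `Theorems/SAWDevelopingMapObservableToSLEShortChordLocalityArchMass.lean`:
  `floorArchMass_le`, `sum_floorArchMass_le`).  (iii) Why no cheap
  proof: cutting a far arch at its first exit of `B(Kn)` over-counts by ignoring mutual avoidance; with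
  the predicted exponents (boundary `5/8`, bulk `5/48`, `Z_H(0→n) ≍ n^{-5/4}`) the union bound is
  `≍ K^{-11/24} n^{19/24}`, NOT uniform in `n` — a genuine separation/arm argument is needed (no FKG for
  SAW).  (iv) Why no cheap disproof: the predicted value is
  `ε_SLE(K) = 1 − (1 − K^{-2})^{5/8} ∼ (5/8)K^{-2}` EXACTLY (§8.2: Möbius `z ↦ z/(1−z)` sends
  `(ℍ; 0, 1)` to `(ℍ; 0, ∞)` and `{|z| ≥ K}` to the closed half-disc of centre `−K²/(K²−1)` and radius
  `K/(K²−1)`, ratio radius/|centre| `= 1/K`; for a half-disc hull of that ratio `Φ_A'(0) = 1 − K^{-2}`;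
  LSW `P = Φ_A'(0)^{5/8}`): `ε_SLE(2) = 0.1646`, `ε_SLE(3) = 0.0710`, `ε_SLE(6) = 0.0175` — the numbers a
  transfer-matrix falsifier (triage jobs j006927/8, `R ≈ 6`) should be compared with.
* `stub_canonicalTransfer`, `stub_chordalCarrier`, `stub_restrictionIdentifies`: re-read against
  `HexSAW.lean` (`embMeshGraph`: closed-segment rule; `embMeshDomain`: UNION of the components of maximal
  `ncard`, so `Ω_δ` may be disconnected on ties — irrelevant for Jordan `D` and small `δ`, but a proof of
  stub 4 must either rule ties out or work in the component of `a δ`; `IsEmbEndpointApprox.reachable`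
  is reflexive junk only when `a δ = b δ`, excluded eventually by `pt 0 ≠ pt 1`).  The event of
  `FloorRestrictionLimit` asks for walks of the MESH graph of `D'` (not of its largest component) —
  correct, the walk is connected and contains `a δ`.  Floor-vertex endpoints exist: with the fixed
  embedding the faces of row `0` have heights `√3δ/6` (up) and `√3δ/3` (down), so a floor at height `0`
  always cuts below the up-faces of row `0`, whose vertical edge goes to row `−1` (zigzag bottom, no
  pendant vertices); `IsFloorEndpointApprox` is satisfiable on `(HD; r, 0)` GIVEN connectivity of the
  canonical honeycomb mesh of `HD` (descent: up-face → the down-face below it, down-face → the up-face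
  below it on the side of the imaginary axis, then along the bottom zigzag to the axis; norms decrease,
  heights stay positive).  That engine is NOT in the tree (the disc engine `NonVacuity` descends
  `9‖c‖² = A²+AB+B²` radially and does not respect a floor); it is the first thing a worker on stub 4 needs,
  and until it lands the NON-VACUITY OF `FloorIdentification`'s endpoint class is uncertified (the
  domain class is certified: §8.4, and `IsFloorDomain (halfDiscDomain r) ρ` for `ρ ≤ min r (1−r)` has
  its two flatness clauses in `Negative.FloorRatioLimitRootPinning_HalfDisc.HD_inter_ball_real`).
* `stub_domainExtension` (W2): unchanged — ≡ the crux given stubs 1–6 (`extension_iff_crux_of_floor`);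
  additionally OUTSIDE the floor class lie the locally-flat domains that dip below the floor line away
  from the marks (`IsFloorDomain` demands `D ⊆ {im > im a}` GLOBALLY): they are hull subdomains of NO
  floor domain, so layer (b) of the stub's docstring (exact restriction from a floor super-domain) does
  not reach them either; for them the whole chain 1–6 would have to be re-run with the global clause
  dropped from the anchor, i.e. with `Λ` arbitrary outside `B(s, 2Kn)` — where monotonicity lands on
  BULK critical two-point masses (finiteness in 2D not in print), as the skeleton says.

### §8.2 The exact SLE(8/3) prediction for the anchor (checked arithmetic) -/

/-- The Möbius map `z ↦ z/(1−z)` of `(ℍ; 0, 1)` onto `(ℍ; 0, ∞)` sends `±K` to `∓K/(K∓1)`: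
the circle `|z| = K` (`K > 1`) goes to the circle with diameter `[−K/(K−1), −K/(K+1)]`. -/
theorem moebius_pm (K : ℝ) (hK : 1 < K) :
    (K : ℝ) / (1 - K) = -(K / (K - 1)) ∧ (-K : ℝ) / (1 - -K) = -(K / (K + 1)) := by
  have h1 : (1 : ℝ) - K ≠ 0 := by linarith
  have h2 : (K : ℝ) - 1 ≠ 0 := by linarith
  have h3 : (1 : ℝ) - -K ≠ 0 := by linarith
  have h4 : (K : ℝ) + 1 ≠ 0 := by linarith
  constructor
  · field_simp; ring
  · field_simp; ring

/-- Centre `c = −K²/(K²−1)` and radius `ρ = K/(K²−1)` of that image circle: the endpoints are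
`c ∓ ρ`, and the shape ratio is `ρ/|c| = 1/K`. -/
theorem image_halfDisc_shape (K : ℝ) (hK : 1 < K) :
    -(K ^ 2) / (K ^ 2 - 1) - K / (K ^ 2 - 1) = -(K / (K - 1)) ∧
    -(K ^ 2) / (K ^ 2 - 1) + K / (K ^ 2 - 1) = -(K / (K + 1)) ∧
    (K / (K ^ 2 - 1)) / (K ^ 2 / (K ^ 2 - 1)) = K⁻¹ := by
  have h2 : (K : ℝ) - 1 ≠ 0 := by linarith
  have h3 : (K : ℝ) + 1 ≠ 0 := by linarith
  have h4 : (K : ℝ) ^ 2 - 1 ≠ 0 := by nlinarith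
  have hK0 : (K : ℝ) ≠ 0 := by linarith
  have e : (K : ℝ) ^ 2 - 1 = (K - 1) * (K + 1) := by ring
  refine ⟨?_, ?_, ?_⟩
  · rw [e]; field_simp; ring
  · rw [e]; field_simp; ring
  · field_simp

/-- The restriction map of the half-disc hull `A = closure B(c, ρ) ∩ ℍ` (`c < 0`, `ρ < |c|`):
`Φ_A(z) = (z − c) + ρ²/(z − c) + c − ρ²/(−c)` (Joukowski after a translation; `Φ_A(0) = 0`,
`Φ_A(z)/z → 1`), with derivative `1 − ρ²/(z − c)²`; at `0` this is `1 − (ρ/c)²`. -/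
theorem hasDerivAt_halfDiscHullMap (c ρ : ℝ) (hc : c ≠ 0) :
    HasDerivAt (fun z : ℂ => (z - c) + (ρ : ℂ) ^ 2 / (z - c) + c + (ρ : ℂ) ^ 2 / c)
      (1 - ((ρ : ℂ) / c) ^ 2) 0 := by
  have hcc : (c : ℂ) ≠ 0 := by exact_mod_cast hc
  have hc' : ((0 : ℂ) - c) ≠ 0 := by rwa [zero_sub, neg_ne_zero]
  have h1 : HasDerivAt (fun z : ℂ => z - c) 1 0 := (hasDerivAt_id (0 : ℂ)).sub_const _
  have h2 : HasDerivAt (fun z : ℂ => (ρ : ℂ) ^ 2 / (z - c))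
      ((0 * ((0 : ℂ) - c) - (ρ : ℂ) ^ 2 * 1) / ((0 : ℂ) - c) ^ 2) 0 :=
    (hasDerivAt_const (0 : ℂ) ((ρ : ℂ) ^ 2)).div h1 hc'
  have h := ((h1.add h2).add_const (c : ℂ)).add_const ((ρ : ℂ) ^ 2 / c)
  have h' : HasDerivAt (fun z : ℂ => (z - c) + (ρ : ℂ) ^ 2 / (z - c) + c + (ρ : ℂ) ^ 2 / c)
      (1 + (0 * ((0 : ℂ) - c) - (ρ : ℂ) ^ 2 * 1) / ((0 : ℂ) - c) ^ 2) 0 := h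
  refine h'.congr_deriv ?_
  rw [zero_mul, zero_sub, zero_sub, neg_sq, div_pow]
  ring

/-- The half-disc hull map vanishes at `0` (normalisation `Φ_A(0) = 0`). -/
theorem halfDiscHullMap_zero (c ρ : ℝ) (hc : c ≠ 0) :
    (fun z : ℂ => (z - c) + (ρ : ℂ) ^ 2 / (z - c) + c + (ρ : ℂ) ^ 2 / c) 0 = 0 := by
  have hcc : (c : ℂ) ≠ 0 := by exact_mod_cast hc
  show ((0 : ℂ) - c) + (ρ : ℂ) ^ 2 / (0 - c) + c + (ρ : ℂ) ^ 2 / c = 0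
  rw [zero_sub, div_neg]
  ring

/-- Hence `Φ_{A_K}'(0) = 1 − K^{-2}` for the image hull of shape ratio `1/K`, and the SLE(8/3) probability
that the arch from `0` to `1` in `ℍ` reaches `{|z| ≥ K}` is `ε_SLE(K) = 1 − (1 − K^{-2})^{5/8}`
(LSW: `P(avoid A) = Φ_A'(0)^{5/8}`).  The elementary bound `ε_SLE(K) ≤ K^{-2}`; first order
`(5/8)K^{-2}`. -/
theorem archExit_prediction_le (K : ℝ) (hK : 1 < K) :
    1 - (1 - (K ^ 2)⁻¹) ^ ((5 : ℝ) / 8) ≤ (K ^ 2)⁻¹ := by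
  have hK2 : 1 < K ^ 2 := by nlinarith
  have hx0 : 0 < 1 - (K ^ 2)⁻¹ := by
    have : (K ^ 2)⁻¹ < 1 := inv_lt_one_of_one_lt₀ hK2
    linarith
  have hx1 : 1 - (K ^ 2)⁻¹ ≤ 1 := by
    have : 0 < (K ^ 2)⁻¹ := by positivity
    linarith
  -- for `x ∈ (0, 1]` and exponent `≤ 1`: `x ≤ x ^ (5/8)`
  have key : 1 - (K ^ 2)⁻¹ ≤ (1 - (K ^ 2)⁻¹) ^ ((5 : ℝ) / 8) := by
    have := Real.rpow_le_rpow_of_exponent_ge hx0 hx1 (show (5 : ℝ) / 8 ≤ 1 by norm_num)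
    rwa [Real.rpow_one] at this
  linarith

/-! ### §8.3 Exact-identity classification for the rev-4 antecedent — why `HexObservableLimit` cannot be
made false (and the crux vacuously provable) CHEAPLY a second time

The 5420 refutation needed NO analysis: two admissible instances with IDENTICAL left-hand sides
(`δ²ΣψF/F(b)`, by corridor peeling) were matched to continuum data with DIFFERENT right-hand sides
(roots `1/2` vs `3/4`), and the universal `c ≠ 0` forced the two predicted densities to agree.  A
second refutation of the repaired item (stmt-14003) by the same logic needs an exact lattice identity
relating the LHS of two admissible families whose continuum data `(D; a, b)` differ.  With the root
AND the normalisation point inside rigid half-lattice balls, the candidates are: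

* T1 lattice symmetries preserving "horizontal floor, domain above": translations and the reflection
  `z ↦ −z̄` (which maps hex rows to rows).  Reflection flips every turning angle, so
  `F_{refl Λ}(refl e) = conj (F_Λ(e))`; the reflected instance is admissible with `Φ̃ = R∘Φ∘R`,
  `L̃ = conj ∘ L ∘ R`, and the statement applied to both gives `conj(c)·Ī = c·Ī` for the (nonzero)
  reflected integral: a CONSEQUENCE — the universal constant is REAL (`const_real_of_conj_symmetry`
  below is the algebraic skeleton) — not a contradiction, and consistent with DCS's orientation-free
  prediction (`c = ρ_hex ·` a real normalisation).
* T2 mesh re-indexing `Λ̃ δ := Λ (2δ)`: discretises `D/2`; LHS scales by `1/4`, RHS by `1/4` (the `δ²`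
  was chosen for this) — consistent.
* T3 dead-end annexes: a region `R` attached to `Λ` through ONE cut vertex is invisible to every
  self-avoiding walk from `a` to a mid-edge outside `R` (it could not leave `R` again), so `F` is
  unchanged off `R`, `F(b)` is unchanged, and with `R` in the `o(1)`-collar (off `supp ψ`) the LHS is
  unchanged — but so is `(D; a, b)`: consistent.  Two macroscopic halves joined by a cut vertex are
  excluded by exhaustion of compacts (a separating moat must leave every compact, i.e. retreat into the
  collar); moats with gaps along `∂D ∖ (B(a,ρ) ∪ B(b,ρ))` change the LHS only through pinhole
  excursions (no identity; analytically `o(1)`).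
* T4 corridor peeling at the source (the 5420 witness): needs the root at a corridor tip — EXCLUDED by
  the rev-4 rigid ball at `pt 0` (`Negative.FloorRatioLimitRootPinning_*` re-derive the peeling identity
  for a second normalisation point instead, which is why the UN-pinned `FloorRatioLimit` was false).
* T5 mesoscopic floor lifts: the typing lets `m_i(δ)` sit `o(δ⁻¹)` rows ABOVE the true floor row inside
  the balls (exhaustion only forces `δ·m_i(δ) → im(pt i)`), producing admissible families with a
  `δ^{1/2}`-step in the floor at `|z − a| = ρ`; they discretise the same `(D; a, b)` and no identity
  relates them to the honest family — consistent as far as exact reasoning goes (a prover of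
  `QCIdentification` must nevertheless HANDLE them: the statement claims the same limit for them).
* T6 DCS's vertex relation (Lemma 1, tree) gives `Σ_p F(p)ψ_φ(p) = 0` exactly for the
  ORIENTATION-weighted test functions `ψ_φ(p) = ((w−v)/2)(φ(v) − φ(w))`; position-only bumps `ψ(δ·p)`
  cannot see orientation, so the identity meets the statement only through orientation
  equidistribution of `F` — which is `InteriorFlattening` (M), open.  No contradiction extractable.
* T7 dimensional consistency: `F_δ(z)/F_δ(b) = O(1)` presumes the bulk parafermion has scaling dimension
  equal to its spin `5/8` (holomorphic field), against the naive `δ^{5/48−5/8}` from the bulk one-leg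
  exponent — the difference is phase decoherence (`E e^{-iσW} ≍ δ^{25/48}`, winding variance
  `κ log δ⁻¹`); this is the CFT picture, unrefuted and unproved; FK-Ising (σ = 1/2, proved) has the same
  structure.  No rigorous handle.

Conclusion: every exact move is consistent; a second refutation of stmt-14003 needs analytic input of
Conjecture-2 strength, so the crux keeps a NOT-trivially-true, non-vacuous first hypothesis (§8.4). -/

/-- Algebraic skeleton of T1: a constant fixed by conjugation against a nonzero test value is real. -/
theorem const_real_of_conj_symmetry {c I : ℂ} (hI : I ≠ 0) (h : (starRingEnd ℂ) c * I = c * I) :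
    c.im = 0 := by
  have hc : (starRingEnd ℂ) c = c := mul_right_cancel₀ hI h
  exact Complex.conj_eq_iff_im.1 hc

/-! ### §8.4 NON-VACUITY certificates (cycle 4; LANDED: `Negative.HalfDiscMesh` p73788,
`Negative.FloorClassNonVacuity` p74449, `Negative.AdmissibleInstance` p74943 — the last one is not yet imported in
this version because the farm snapshot serving crux work files has not built it; its statements are quoted)

Three hypothesis classes of the line are now CERTIFIED inhabited by checked instances on the half-disc
`(HD; 1/4, 0)` (so none of the stubs 1, 3, 4, 5 or the premise of stub 7 is provable by vacuity, and the
rev-4 antecedent is a genuine `∀` over a nonempty class — not trivially true):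

* the hypothesis class of `HexObservableLimit` rev 4 (item 14003): `hexObservableLimit_hypotheses_inhabited`
  (floor-rooted body family `Lam δ false`, root `bEdgeQ (Nc δ) → 1/4`, `bEdge → 0`, `Φ_{1/4}`, `Lfun`),
  with the concrete consequence `floorInstance_of_hexObservableLimit`;
* the floor DOMAIN class `IsFloorDomain` and the floor ENDPOINT class `IsFloorEndpointApprox` of the
  CANONICAL discretisation: `floorClass_inhabited`, through the new half-disc mesh engine
  (`hexDomainGraph_HD_reachable`: `Ω_δ(HD)` is the whole honeycomb mesh of `HD`, reachability =
  membership, `0 < δ < 1`).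

Not certified (and not needed beyond a standard named fact): the `IsChordalUniformizing φ` hypothesis of
`AdmissibleRestrictionLimit` / `FloorRestrictionLimit` — inhabited modulo the tree's named fact
`MarkedDomain.exists_isChordalUniformizing` (an explicit `φ = (J ∘ Φ_{1/4})⁻¹` would discharge it for
`HD`; left to the stub-3/4 workers), with `D' = D`, `A = ∅`, `Φ_∅ = id`, `d = 1`
(`isHullSubdomain_self`, `isRestrictionMap_empty`, `hasRestrictionDeriv_empty`). -/

/-- Re-export: the canonical honeycomb mesh of the half-disc is one component (`Negative.HalfDiscMesh`). -/
example {δ : ℝ} (hδ : 0 < δ) (hδ1 : δ < 1) {u w : HexVertex} (hu : u ∈ meshHD δ) (hw : w ∈ meshHD δ) :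
    (hexDomainGraph Summit.CriticalPhenomena.SAWScalingLimit.Theorems.BoundaryClosure.Negative.HD δ).Reachable
      u w :=
  hexDomainGraph_HD_reachable hδ hδ1 hu hw

/-- Re-export: the floor class is inhabited (`Negative.FloorClassNonVacuity`). -/
example : ∃ (D : DobrushinDomain) (ρ : ℝ) (a b : ℝ → HexVertex),
    (0 < ρ ∧ (D.pt 1).im = (D.pt 0).im ∧ D.carrier ⊆ {z : ℂ | (D.pt 0).im < z.im} ∧
      D.carrier ∩ Metric.ball (D.pt 0) ρ = {z : ℂ | (D.pt 0).im < z.im} ∩ Metric.ball (D.pt 0) ρ ∧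
      D.carrier ∩ Metric.ball (D.pt 1) ρ = {z : ℂ | (D.pt 1).im < z.im} ∩ Metric.ball (D.pt 1) ρ) ∧
    (IsEmbEndpointApprox hexGraph hexCenter D a b ∧
      ∀ᶠ δ : ℝ in 𝓝[>] 0,
        (∃ u : HexVertex, hexGraph.Adj (a δ) u ∧ ((δ : ℂ) * hexCenter u).im ≤ (D.pt 0).im) ∧
        (∃ u : HexVertex, hexGraph.Adj (b δ) u ∧ ((δ : ℂ) * hexCenter u).im ≤ (D.pt 1).im)) :=
  floorClass_inhabited

/-! ## §9 Cycle 5 (gen 5, 2026-08-16): stub 5 decomposed and its natural strengthening refuted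
(LANDED: `Negative.ChordalCarrier`, p76405 ✓), the dimensional attack T7 closed, stub 2 as a limit
interchange, W2 versus Carathéodory approximation, and the fallback lines' distinctive stubs

### §9.1 Stub 5 (`stub_chordalCarrier`: `FloorRestrictionLimit →` subsequential limits are carried by
`chordalCarrier D`) — conclusion implied by Conj. 1 (checked), hypothesis RANGE-BLIND (checked)

`chordalCarrier D = simple ∩ {source = a} ∩ {target = b} ∩ {range ⊆ D ∪ {a,b}}` (tree,
`HullRestrictionTests`).  Two checked facts, landed as `Negative.ChordalCarrier` (quoted here with local
names because the farm snapshot serving crux work files lags the Theorems tree):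

* `sle_charges_chordalCarrier` / `stub5_conclusion_of_hexConjecture` below: every SLE_κ law, `0 < κ ≤ 4`,
  is carried by the chordal carrier (the tree's Rohde–Schramm and Carathéodory discharges), hence under
  `HexConjecture` so is every subsequential limit law of the critical hexagonal SAW, for EVERY Dobrushin
  domain and endpoint approximation.  Stub 5 (and `noRetrace` of coalescent-arc, and every "range →
  curve" step) is therefore NOT refutable short of `¬HexConjecture` — same status as the crux.
* NATURAL STRENGTHENING REFUTED (`Negative.ChordalCarrier.not_mem_chordalCarrier_of_rangeData`,
  `exists_dirac_same_rangeData`): membership in `chordalCarrier D` is NOT a function of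
  `(range, source, target)`.  Witness: for ANY chordal simple class `⟦γ⟧` the back-tracking
  `⟦γ ∘ zigzag⟧`, `zigzag t = t + (8/3)t(1−t)(1−2t)` (continuous surjection of `[0,1]` fixing `0, 1`,
  `zigzag(1/4) = zigzag(3/4) = 1/2 ≠ 43/81 = zigzag(1/3)`), has the same trace and endpoints and is not
  a simple class (a representative of a simple class is FLAT — `isFlat_of_mk_mem_simple`, from the tree's
  injectivity moduli — and `γ ∘ zigzag` is not); the two Dirac laws agree on every event `{range ⊆ S}`,
  `{source = z}`, `{target = z}` and charge the carrier `1` resp. `0`.  CONSEQUENCE: hull-avoidance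
  probabilities — `FloorRestrictionLimit`, `AdmissibleRestrictionLimit`, LSW's `Φ_A'(0)^{5/8}` — are
  range data; no amount of them yields CLASS simplicity.

DECOMPOSITION of stub 5 for its worker (what the hypothesis gives and what it cannot):
* (5a) BOUNDARY AVOIDANCE of subsequential limits, `μ(range ∩ ∂D ⊆ {a,b}) = 1` — PROVABLE from
  `FloorRestrictionLimit` + portmanteau.  For `Z_n = ∂D ∖ (B(a,1/n) ∪ B(b,1/n))` and `η > 0` the event
  `E_η = {range meets the open η-neighbourhood of Z_n}` is OPEN in `CurveClass ℂ`, so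
  `μ(E_η) ≤ liminf_k P_{δ_k}(E_η)`; a lattice curve in `E_η` has a vertex within `η + δ` of `Z_n`, hence
  is not a `D'`-walk for the hull subdomain `D' = φ(ℍ ∖ A)`, `A` a smooth hull covering
  `φ⁻¹(U_{2η}(Z_n) ∩ D)` (bounded away from `0, ∞` because `Z_n` is away from `a, b`; `φ⁻¹` continuous on
  `cl D`), so `μ(E_η) ≤ 1 − Φ'_A(0)^{5/8} → 0` as `η → 0` (the hulls shrink to a compact piece of `ℝ`);
  then the countable union over `n` — every boundary point other than `a, b` lies in some `Z_n`, so
  nothing special is needed near the marked points.  (Quantitative variant near `a`: `r/η` half-disc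
  hulls of radius `2η` on `[r, 2r]`, each charged `≤ 4η²/x²` by §8.2, total `4η/r`, `floorNet_bound`.)
* (5b) "a.s. THE RANGE IS A SIMPLE ARC from `a` to `b` in `D ∪ {a,b}`" — follows from the restriction
  limits at the level of random closed SETS (LSW: the law of the filled range is determined by the
  hull-avoidance probabilities; the `5/8` restriction set is the SLE(8/3) trace, a simple arc by
  Rohde–Schramm; a connected range inside an arc containing both its endpoints is the arc).  Needs the
  SET-level LSW uniqueness, which the tree has only on `chordalCarrier`
  (`CurveClass.Measure.ext_of_missCode_injOn`) — a formalization gap, not a mathematical one.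
* (5c) NO BACKTRACKING — the open core and the whole content of stub 5 beyond its hypothesis: a.s. the
  limit class does not traverse a sub-arc forth–back–forth.  Lattice form: three disjoint sub-walks of
  `γ_δ` ε-close to one arc of diameter `≥ ℓ`.  WHY FIRST-MOMENT ARM COUNTING CANNOT PROVE IT (checked
  exponent arithmetic in §9.3): with the polymer network exponents `x_L = 3L²/16 − 1/12`
  (`x₁ = 5/48`, `x₂ = 2/3`, `x₃ = 77/48`, `x₄ = 35/12`), the expected number of `r`-cells with three
  crossings from scale `s` is `≍ ℓ⁻¹ s^{x₃−2} r^{1+x₂−x₃}` per needed cell, exponents `−19/48 < 0` and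
  `+1/16`: divergent as `s → 0`, and at `s ≍ r` it is the curve's own cell count `r^{-4/3} ≫ ℓ/r`;
  backtracking is a COHERENCE event (the same three strands in `ℓ/r` consecutive cells), invisible to
  first moments.  By contrast DOUBLE POINTS would be excluded by a first moment IF a 4-arm bound with
  exponent `> 2` were available (`x₄ = 35/12 > 2`) — none is in print for SAW.  The nearest printed
  tool making CONFINED critical SAW mass small uniformly in the mesh is bridge decay
  `B_T(x_c) → 0` (Beaton–Bousquet-Mélou–de Gier–Duminil-Copin–Guttmann 2014, via Duminil-Copin–Hammond
  2013 sub-ballisticity); a no-backtracking proof would have to chain it along a fractal corridor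
  (domain Markov property of the SAW gives the conditioning, not the straightness).  OPEN-PROBLEM
  strength, as recorded in §6; now localized to (5c).

### §9.2 T7 closed: the typed normalisation of `HexObservableLimit` is dimensionally CONSISTENT

`F_δ(b) = e^{−iσW_{ab}} Z_δ(a→b) ≍ δ^{η_∥}`, `η_∥ = 2·(5/8) = 5/4`; `|F_δ(z)| ≤ Z_δ(a→z) ≍ δ^{η_⊥}`,
`η_⊥ = 5/8 + 5/48 = 35/48` (boundary one-leg weight `5/8`, bulk one-leg `x₁ = 5/48`; Fisher/Cardy
relations `γ = (2−η)ν = 43/32`, `γ₁ = (2−η_⊥)ν = 61/64`, `γ₁₁ = (1−η_∥)ν = −3/16`, `2η_⊥ = η + η_∥`,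
all checked in `sawExponent_bookkeeping`).  DCS Conjecture 2 / Smirnov's half-plane martingale
`G = (Ψ'(z)/Ψ'(b))^{5/8}` (ICM 2006 Prop. 11, eq. (16): `α = 3/κ − 1/2 = 5/8` at `κ = 8/3`,
scale-free) requires `|F_δ(z)| ≍ δ^{5/4}`, i.e. a phase cost `⟨e^{−iσW}⟩_{a→z} ≍ δ^{5/8 − 5/48} = δ^{25/48}`,
i.e. (Gaussian winding) `Var W_tip = κ log δ⁻¹` exactly (`σ²κ/2 = 25/48`, `phaseCost_saw`).  This IS the
printed winding law at a polymer END: Duplantier–Saleur 1988, `⟨θ²⟩ = 2 ln N = κν ln N`; Coulomb gas: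
an extra phase `e^{ipθ}` is an extra electric charge `2p`, dimension shift `(2p)²/(2g) = p²κ/2`.
Cross-check on the PROVED case (FK-Ising, `σ = 1/2`, `κ = 16/3`, interior point of the interface =
two strands, Duplantier–Binder `Var_k = (κ/k²) log`): phase cost `σ²(κ/4)/2 = 1/6 = 1/2 − 1/3`
(fermion weight minus two-arm exponent; `phaseCost_fk`), matching "properly normalized `F` converges to
`√Φ'`" (Smirnov, ICM 2006 §5.6).  So T7 yields no lever: the `O(1)` normalisation `F(z)/F(b)` is the
right one.  (Search-degraded note: `lit search` was unavailable this cycle (searchd rc 75); DS88/DB02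
are quoted from memory + the Coulomb-gas derivation above; Smirnov ICM 2006 was read at page level.)

### §9.3 Checked arithmetic for §9.1–§9.2 -/

/-- Polymer (O(n→0), `g = 3/2`, `κ = 8/3`) network exponents `x_L = gL²/8 − (1−g)²/(2g) = 3L²/16 − 1/12`:
one leg `5/48`, two legs `2/3 = 2 − 4/3`, three legs `77/48 < 2`, four legs `35/12 > 2`. -/
theorem polymerExponents :
    (3 : ℝ) * 1 ^ 2 / 16 - 1 / 12 = 5 / 48 ∧ (3 : ℝ) * 2 ^ 2 / 16 - 1 / 12 = 2 / 3 ∧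
    (3 : ℝ) * 3 ^ 2 / 16 - 1 / 12 = 77 / 48 ∧ (3 : ℝ) * 4 ^ 2 / 16 - 1 / 12 = 35 / 12 ∧
    (77 : ℝ) / 48 < 2 ∧ (2 : ℝ) < 35 / 12 := by norm_num

/-- First-moment obstruction for (5c): exponent of the cell scale `s` is `x₃ − 2 = −19/48 < 0`
(divergent), exponent of `r` is `1 + x₂ − x₃ = 1/16`; at `s = r` the count is `r^{x₂ − 2} = r^{-4/3}`
cells, against the `ℓ/r` needed. -/
theorem firstMoment_obstruction :
    (77 : ℝ) / 48 - 2 = -19 / 48 ∧ (1 : ℝ) + 2 / 3 - 77 / 48 = 1 / 16 ∧ (2 : ℝ) / 3 - 2 = -4 / 3 := by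
  norm_num

/-- (5a) the floor net: `r/η` hulls, each charged `≤ 4η²/r²`, total `4η/r`. -/
theorem floorNet_bound {r η : ℝ} (hr : 0 < r) (hη : 0 < η) :
    r / η * (4 * η ^ 2 / r ^ 2) = 4 * η / r := by
  field_simp

/-- SAW exponent bookkeeping behind T7: `η_∥ = 5/4`, `η_⊥ = 35/48`, `η = 5/24`, `ν = 3/4` give
`γ = 43/32`, `γ₁ = 61/64`, `γ₁₁ = −3/16` and the scaling relation `2η_⊥ = η + η_∥`. -/
theorem sawExponent_bookkeeping :
    (2 - (5 : ℝ) / 24) * (3 / 4) = 43 / 32 ∧ (2 - (35 : ℝ) / 48) * (3 / 4) = 61 / 64 ∧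
    (1 - (5 : ℝ) / 4) * (3 / 4) = -3 / 16 ∧ 2 * ((35 : ℝ) / 48) = 5 / 24 + 5 / 4 ∧
    (5 : ℝ) / 8 + 5 / 48 = 35 / 48 ∧ 2 * ((5 : ℝ) / 8) = 5 / 4 := by norm_num

/-- Phase cost at a polymer END (one strand, `Var = κ log`): `σ²κ/2 = 25/48 = 5/8 − 5/48` — exactly the
gap between the parafermion weight and the bulk one-leg exponent, so `F(z)/F(b) = O(1)`. -/
theorem phaseCost_saw : ((5 : ℝ) / 8) ^ 2 * (8 / 3) / 2 = 25 / 48 ∧ (5 : ℝ) / 8 - 5 / 48 = 25 / 48 := by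
  norm_num

/-- Phase cost at an interior point of the FK-Ising interface (two strands, `Var = (κ/4) log`):
`σ²(κ/4)/2 = 1/6 = 1/2 − 1/3` (fermion weight minus the two-arm exponent `2 − (1 + κ/8)`). -/
theorem phaseCost_fk :
    ((1 : ℝ) / 2) ^ 2 * ((16 / 3) / 4) / 2 = 1 / 6 ∧ (1 : ℝ) / 2 - (2 - (1 + (16 : ℝ) / 3 / 8)) = 1 / 6 := by
  norm_num

/-- §9.1 checked: every SLE_κ law with `0 < κ ≤ 4` charges the chordal carrier (local copy of
`Negative.ChordalCarrier.ae_mem_chordalCarrier_of_isSLELaw`). -/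
theorem sle_charges_chordalCarrier {κ : ℝ≥0} (h0 : 0 < κ) (h4 : κ ≤ 4) {D : DobrushinDomain}
    {μ : Measure (CurveClass ℂ)} (h : IsSLELaw κ D μ) : ∀ᵐ c ∂μ, c ∈ chordalCarrier D := by
  filter_upwards [IsSLELaw.ae_endpoints JordanDomain.mapsTo_boundaryExtension_holds h,
    IsSLELaw.ae_simple ae_isSimpleTrace_sleTrace_of_le_four_holds
      CurveClass.measurableSet_simple_holds h0 h4 h] with c h1 h2
  obtain ⟨hs, ht, hr⟩ := h1
  obtain ⟨hsim, hfr⟩ := h2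
  refine ⟨⟨⟨hsim, hs⟩, ht⟩, fun w hw => ?_⟩
  have hw' := hr hw
  rw [closure_eq_self_union_frontier] at hw'
  rcases hw' with h' | h'
  · exact Or.inl h'
  · exact Or.inr (hfr ⟨hw, h'⟩)

/-- §9.1 checked: the CONCLUSION of stub 5 (for every Dobrushin domain and endpoint approximation)
follows from `HexConjecture` (local copy of `Negative.ChordalCarrier.chordalCarrier_of_hexConjecture`). -/
theorem stub5_conclusion_of_hexConjecture (h : SAWDevelopingMap.HexConjecture)
    (D : DobrushinDomain) (a b : ℝ → HexVertex) (hab : IsEmbEndpointApprox hexGraph hexCenter D a b)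
    (μ : Measure (CurveClass ℂ)) (hμ : IsProbabilityMeasure μ)
    (hsub : IsSubseqLimitLaw (fun δ (γ : HexDomainSAW D.carrier δ (a δ) (b δ)) => γ.curve)
      (fun δ => hexSAWLaw D.carrier δ (a δ) (b δ)) μ) :
    ∀ᵐ c ∂μ, c ∈ chordalCarrier D := by
  refine sle_charges_chordalCarrier (κ := (8 : ℝ≥0) / 3) (by positivity) ?_
    (identification_of_hexConjecture h D a b hab μ hμ hsub)
  rw [div_le_iff₀ (by norm_num : (0 : ℝ≥0) < 3)]
  norm_num

/-! ### §9.4 Stub 2 (anchor) as a limit interchange; W2 versus Carathéodory; status of the targets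

* STUB 2.  `ShortChordLocality` ≡ half-plane arch tightness `sup_n f(K,n) → 0` (§8.1(ii)), where
  `f(K,n)` = fraction of the `x_c`-mass of half-plane arches between floor mid-edges at distance `n`
  that reach distance `Kn`.  `f` is DEcreasing in `K` for each `n`, and for each fixed `n` it is the tail
  of a convergent series (`→ 0` as `K → ∞`, DCS Lemma 2).  Hence: IF for every `K > 1` the limit
  `lim_n f(K,n) =: ε(K)` exists and `ε(K) → 0` — e.g. `ε(K) = ε_SLE(K) = 1 − (1 − K⁻²)^{5/8}` from
  convergence of the normalised half-plane arch measure to SLE(8/3) in `(ℍ; 0, 1)` (portmanteau; the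
  exit event has SLE-null boundary) — THEN the uniform statement follows (given `ε`, pick `K₀` with
  `ε(K₀) < ε/2`, `N` with `f(K₀,n) ≤ ε` for `n ≥ N`, then `K₁ ≥ K₀` for the finitely many `n < N`;
  monotonicity in `K`).  So the anchor is implied by HALF-PLANE arch convergence alone — not by the
  typed `HexConjecture` (bounded domains), and conversely it is the natural input for it.  Not refutable
  in the SLE picture; no finite computation bears on it (unchanged).
* W2 / STUB 7.  The conclusion class is not reachable from the floor class by Carathéodory
  approximation either: every floor domain lies above the horizontal line through its two marked points,
  so a kernel limit of floor domains `(D_n; a_n, b_n) → (D; a, b)` lies above the line through `a, b` —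
  `(𝔻; 1, −1)` (below its marks' line on half its area) is not such a limit, and neither is any domain
  with a CURVED boundary at a marked point a member of the class (exact flatness in a ball).  Lattice
  rotations by `±60°` transport `HexObservableLimit` to zigzag floors in three directions and nothing
  else (a vertical tangent is an armchair edge).  Recommendation unchanged: promote `stub_domainExtension`
  to a route item (boundary universality at the marked points) unless a transfer mechanism is named.
* TARGETS (7 registered stubs of `Lines/floor-ratio-restriction-bootstrap.lean`): 0 broken after three
  audits; stub 1 landed (`Theorems/SAWDevelopingMapObservableToSLETargetTransport.lean`); anchor worker
  has the arch-mass vocabulary (`…ShortChordLocalityArchMass.lean`, `…Helpers.lean`); no STUCK stubs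
  reported to this seat (payload `stuck_stubs = []`).
* FALLBACK LINES (cheap audit of their distinctive stubs, in case the lead switches; PICKED.md order
  source-residue > coalescent-arc).  `source-residue/stub_uniformTargetTransport`: PROVABLE from the
  rev-4 hypothesis — inside `B(a, ρ)` the boundary mid-edges in the annulus `r ≤ |δ·mid p − a| ≤ r₀ < ρ`
  are exactly floor edges (rows exact there), each continuum offset `x` is a legitimate second
  normalisation point (flat ball `B(a+x, ρ−r₀)`, same `m`), and UNIFORMITY over the annulus is free:
  a violating sequence `(δ_k, p_k)`, `x_k → x*`, extends to a family `b'(δ) → a + x*` over all `δ`, to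
  which `HexObservableLimit` applies, contradiction by continuity of `ℓ`.  `source-residue/stub_farExitMassBound`
  (`Σ_{far p} Z(a→p) ≤ (C/δ) Z(a→b)` given `≤ N/δ` far boundary mid-edges): no cheap counterexample from
  ROUGH far boundaries — with `Z(a→p) ≍ δ^{5/8}·ω_p^{5/8}` (`ω_p` the harmonic size of edge `p`,
  `Σ ω_p ≲ 1`), Hölder gives `Σ_p ω_p^{5/8} ≤ n^{3/8} (Σ ω_p)^{5/8} ≤ (N/δ)^{3/8}`, i.e. the SMOOTH
  equidistributed boundary is extremal and yields exactly `δ^{1/4} ≍ Z(a→b)/δ`; isolated slit tips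
  (`|Φ'|^{5/8} ∼ dist^{−5/16}`) are integrable, combs are screened.  SLE-consistent, open (it presumes the
  boundary one-arm bound `Z(a→p) ≲ ω_p^{5/8}` uniformly in the lattice shape).  `coalescent-arc/stub_targetTransport`:
  typed BEFORE rev 4 with rigid rows at `pt 1` and `s` only (none at the root, no flatness of `D` at
  `pt 0`): FALSE as typed by the corridor witness exactly like `FloorRatioLimitUnpinned`
  (`Negative.FloorRatioLimitRootPinning_*`), as PICKED.md already records — must be reshaped (root clause)
  before registration; not re-proved here for an unpicked line.
-/

/-! ## §10 Cycle 6 (gen 6, 2026-08-16): the uniform injectivity modulus is NECESSARY (W6, checked),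
the rev-4 antecedent re-audited for the remaining instance freedoms, deep starts, the anchor versus
Conj. 1, and the printed lattice-effect / Monte-Carlo record

### §10.1 W6 — `HexConjecture → UIM` (local copies of `Negative.ModulusNecessity`, proposal pending)

Since cycle 5 the line has landed `stub_chordalCarrier` MODULO one isolated lattice estimate, the
uniform injectivity modulus UIM (`FloorRatio.stub_chordalCarrier_ofModulus`, first hypothesis:
`∀ ε η > 0, ∃ θ > 0, ∀ᶠ δ, P_δ(curve ∉ modulusClass ε θ) ≤ η` on floor domains), and has shown that the
sibling vertex-level typing `NoRetrace` implies it (`FloorRatio.uniformModulus_of_noRetrace`).  The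
cheap-arsenal verdict on this NEW target: it is implied by the crux's conclusion — so it is SOUND (no
junk refutation: a junk-false UIM would refute DCS Conjecture 1 as typed) and NOT refutable
independently of Conj. 1, exactly like tightness (W5).  Mechanism of the proof (all in the tree):
Rohde–Schramm simplicity of SLE_κ, `κ ≤ 4` (`IsSLELaw.ae_simple`); the simple classes lie in
`⋃ₘ modulusClass (ε/2) (1/(m+1))` (`Curve.IsSimple.exists_mem_modulusSet`); continuity from above
gives a CLOSED `G = modulusClass (ε/2) θ₀` with `μ Gᶜ < η/2`; injectivity moduli are STABLE in the
reparametrisation distance (`mem_modulusClass_of_dist_lt`: an `r`-neighbour of a class of modulus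
`(ε', θ')` has modulus `(ε' + 2r, θ' − 2r)`), so the open bad event `(modulusClass ε (θ₀ − 2r))ᶜ`,
`r = min θ₀ ε / 4`, is at distance `≥ r` from `G`; the Urysohn function `min 1 (infDist · G / r)`
and `TendstoLaw` along `𝓝[>] 0` finish.  What UIM needs on the LATTICE is unchanged from §9.1 (5c):
a no-backtracking estimate uniform in the mesh, for which bridge decay / strip subcriticality at
`x_c` (BBDDG 2014, DCH 2013) is the only printed raw material. -/

/-- W6, stability of injectivity moduli (curves): `dist γ γ' < r` and `γ' ∈ modulusSet ε θ` give
`γ ∈ modulusSet (ε + 2r) (θ − 2r)`. [folklore] -/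
theorem mem_modulusSet_of_dist_lt {E : Type*} [PseudoMetricSpace E] {ε θ r : ℝ} {γ γ' : Curve E}
    (hγ' : γ' ∈ (Curve.modulusSet ε θ : Set (Curve E))) (hd : dist γ γ' < r) :
    γ ∈ (Curve.modulusSet (ε + 2 * r) (θ - 2 * r) : Set (Curve E)) := by
  intro s u t hsu hut hst
  obtain ⟨φ, hφ⟩ := Curve.exists_dist_reparam_lt hd
  have hmem := Curve.reparam_mem_modulusSet hγ' φ
  set γ'' := γ'.reparam φ
  have hpt : ∀ x, dist (γ x) (γ'' x) < r := fun x ↦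
    (ContinuousMap.dist_apply_le_dist (f := γ.toContinuousMap) (g := γ''.toContinuousMap) x).trans_lt
      hφ
  have h1 : dist (γ'' s) (γ'' t) < θ := by
    have h4 := dist_triangle4 (γ'' s) (γ s) (γ t) (γ'' t)
    have hs := hpt s
    have ht := hpt t
    rw [dist_comm] at hs
    linarith
  have h2 := hmem s u t hsu hut h1
  have h4 := dist_triangle4 (γ s) (γ'' s) (γ'' u) (γ u)
  have hs := hpt s
  have hu := hpt u
  rw [dist_comm] at hu
  linarith

/-- W6, stability of injectivity moduli (classes). [folklore] -/
theorem mem_modulusClass_of_dist_lt {E : Type*} [MetricSpace E] {ε θ r : ℝ} {c c' : CurveClass E}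
    (hc' : c' ∈ CurveClass.modulusClass ε θ) (hd : dist c c' < r) :
    c ∈ CurveClass.modulusClass (ε + 2 * r) (θ - 2 * r) := by
  obtain ⟨γ, rfl⟩ := CurveClass.surjective_mk c
  obtain ⟨γ', rfl⟩ := CurveClass.surjective_mk c'
  rw [CurveClass.dist_mk_mk] at hd
  exact ⟨γ, rfl, mem_modulusSet_of_dist_lt (CurveClass.mem_modulusSet_of_mk_mem hc') hd⟩

/-- Constant classes have every modulus with `ε ≥ 0` (the modulus events are nonempty). [folklore] -/
theorem const_mem_modulusClass {E : Type*} [MetricSpace E] (x : E) {ε : ℝ} (hε : 0 ≤ ε) (θ : ℝ) :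
    CurveClass.mk (Curve.const x) ∈ CurveClass.modulusClass ε θ := by
  refine ⟨Curve.const x, rfl, fun s u t _ _ _ ↦ ?_⟩
  rw [Curve.const_apply, Curve.const_apply, dist_self]
  exact hε

/-- A class without modulus `(ε' + 2r, θ' − 2r)` is at distance `≥ r` from `modulusClass ε' θ'`.
[folklore] -/
theorem le_infDist_modulusClass {ε' θ' r : ℝ} (hε' : 0 ≤ ε') {c : CurveClass ℂ}
    (hc : c ∉ CurveClass.modulusClass (ε' + 2 * r) (θ' - 2 * r)) :
    r ≤ Metric.infDist c (CurveClass.modulusClass ε' θ') := by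
  by_contra h
  rw [not_le] at h
  have hne : (CurveClass.modulusClass ε' θ' : Set (CurveClass ℂ)).Nonempty :=
    ⟨_, const_mem_modulusClass (0 : ℂ) hε' θ'⟩
  obtain ⟨c', hc', hd⟩ := (Metric.infDist_lt_iff hne).1 h
  exact hc (mem_modulusClass_of_dist_lt hc' hd)

/-- **W6: UIM IS NECESSARY.**  Convergence in law of the critical hexagonal SAW curve classes to
chordal SLE_κ, `0 < κ ≤ 4`, forces the uniform injectivity modulus. [folklore] -/
theorem uniformModulus_of_convergesInLawToSLE {κ : ℝ≥0} (h0 : 0 < κ) (h4 : κ ≤ 4)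
    {D : DobrushinDomain} {a b : ℝ → HexVertex}
    (h : ConvergesInLawToSLE κ D (fun δ (γ : HexDomainSAW D.carrier δ (a δ) (b δ)) => γ.curve)
      (fun δ => hexSAWLaw D.carrier δ (a δ) (b δ)))
    {ε η : ℝ} (hε : 0 < ε) (hη : 0 < η) :
    ∃ θ : ℝ, 0 < θ ∧ ∀ᶠ δ : ℝ in 𝓝[>] 0,
      hexSAWLaw D.carrier δ (a δ) (b δ) {γ | γ.curve ∉ CurveClass.modulusClass ε θ} ≤
        ENNReal.ofReal η := by
  classical
  have hab : IsEmbEndpointApprox hexGraph hexCenter D a b :=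
    isEmbEndpointApprox_of_convergesInLawToSLE h
  obtain ⟨Γ, hΓ, -, hT⟩ := h
  haveI := isProbabilityMeasure_preWienerMeasure'
  set μ : Measure (CurveClass ℂ) := Process.preWienerMeasure.map Γ with hμ
  haveI hμP : IsProbabilityMeasure μ := Measure.isProbabilityMeasure_map hΓ.aemeasurable
  have hSLE : IsSLELaw κ D μ := ⟨Γ, hΓ, rfl⟩
  have hsimple : ∀ᵐ c ∂μ, c ∈ CurveClass.simple :=
    (IsSLELaw.ae_simple ae_isSimpleTrace_sleTrace_of_le_four_holds
      CurveClass.measurableSet_simple_holds h0 h4 hSLE).mono fun c hc => hc.1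
  set F : ℕ → Set (CurveClass ℂ) := fun m => (CurveClass.modulusClass (ε / 2) (1 / ((m : ℝ) + 1)))ᶜ
    with hF
  have hFmeas : ∀ m, MeasurableSet (F m) := fun m =>
    (CurveClass.isClosed_modulusClass _ _).measurableSet.compl
  have hFanti : Antitone F := by
    intro m n hmn
    refine Set.compl_subset_compl.2 (CurveClass.modulusClass_mono le_rfl ?_)
    have : (m : ℝ) + 1 ≤ (n : ℝ) + 1 := by exact_mod_cast Nat.succ_le_succ hmn
    exact one_div_le_one_div_of_le (by positivity) this
  have hFnull : μ (⋂ m, F m) = 0 := by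
    refine measure_mono_null ?_ (ae_iff.1 hsimple)
    intro c hc hcs
    obtain ⟨γ, hγ, rfl⟩ := hcs
    obtain ⟨θ₁, hθ₁, hmem⟩ := Curve.IsSimple.exists_mem_modulusSet hγ (ε := ε / 2) (half_pos hε)
    obtain ⟨m, hm⟩ := exists_nat_one_div_lt hθ₁
    have hcm : CurveClass.mk γ ∈ CurveClass.modulusClass (ε / 2) (1 / ((m : ℝ) + 1)) :=
      ⟨γ, rfl, Curve.modulusSet_mono le_rfl hm.le hmem⟩
    exact (Set.mem_iInter.1 hc m) hcm
  have hFtend : Tendsto (fun m => μ (F m)) atTop (𝓝 0) := by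
    have := tendsto_measure_iInter_atTop (μ := μ) (fun m => (hFmeas m).nullMeasurableSet) hFanti
      ⟨0, measure_ne_top μ _⟩
    rwa [hFnull] at this
  have hη2 : (0 : ℝ≥0∞) < ENNReal.ofReal (η / 2) := ENNReal.ofReal_pos.2 (half_pos hη)
  obtain ⟨m, hm⟩ := (hFtend.eventually (gt_mem_nhds hη2)).exists
  set θ₀ : ℝ := 1 / ((m : ℝ) + 1) with hθ₀
  have hθ₀pos : 0 < θ₀ := by positivity
  set r : ℝ := min θ₀ ε / 4 with hr
  have hrpos : 0 < r := by positivity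
  have hrθ : 2 * r ≤ θ₀ / 2 := by
    have : min θ₀ ε ≤ θ₀ := min_le_left _ _
    rw [hr]; linarith
  have hrε : ε / 2 + 2 * r ≤ ε := by
    have : min θ₀ ε ≤ ε := min_le_right _ _
    rw [hr]; linarith
  set θ : ℝ := θ₀ - 2 * r with hθ
  have hθpos : 0 < θ := by rw [hθ]; linarith
  refine ⟨θ, hθpos, ?_⟩
  set G : Set (CurveClass ℂ) := CurveClass.modulusClass (ε / 2) θ₀ with hG
  have hGclosed : IsClosed G := CurveClass.isClosed_modulusClass _ _
  have hμG : μ Gᶜ < ENNReal.ofReal (η / 2) := hm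
  obtain ⟨g, hg0, hg1, hgG, hgfar⟩ := exists_urysohn_infDist G hrpos
  set U : Set (CurveClass ℂ) := (CurveClass.modulusClass ε θ)ᶜ with hU
  have hUmeas : MeasurableSet U := (CurveClass.isClosed_modulusClass _ _).measurableSet.compl
  have hgU : ∀ x ∈ U, g x = 1 := by
    intro x hx
    refine hgfar x (le_infDist_modulusClass (half_pos hε).le fun hx' => hx ?_)
    exact CurveClass.modulusClass_mono hrε le_rfl hx'
  have hlim : ∫ x, g x ∂μ < η := by
    refine (integral_urysohn_le hGclosed hg1 hgG).trans_lt ?_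
    rw [measureReal_def]
    have h1 : (μ Gᶜ).toReal ≤ η / 2 := ENNReal.toReal_le_of_le_ofReal (by positivity) hμG.le
    linarith
  have ht := hT g
  have hint_eq : ∫ ω, g (Γ ω) ∂Process.preWienerMeasure = ∫ x, g x ∂μ :=
    (integral_map hΓ.aemeasurable g.continuous.aestronglyMeasurable).symm
  rw [hint_eq] at ht
  have hev : ∀ᶠ δ in 𝓝[>] (0 : ℝ),
      ∫ γ, g ((fun γ : HexDomainSAW D.carrier δ (a δ) (b δ) => γ.curve) γ)
        ∂hexSAWLaw D.carrier δ (a δ) (b δ) < η :=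
    ht.eventually (Iio_mem_nhds hlim)
  filter_upwards [hev, eventually_isProbabilityMeasure_hexSAWLaw hab] with δ hδ hP
  haveI := hP
  have h1 : (hexSAWLaw D.carrier δ (a δ) (b δ)).real
      ((fun γ : HexDomainSAW D.carrier δ (a δ) (b δ) => γ.curve) ⁻¹' U) ≤
      ∫ γ, g ((fun γ : HexDomainSAW D.carrier δ (a δ) (b δ) => γ.curve) γ)
        ∂hexSAWLaw D.carrier δ (a δ) (b δ) :=
    measureReal_preimage_le_integral (EmbDomainSAW.measurable_of_top _) hUmeas hg0 hgU
  change hexSAWLaw D.carrier δ (a δ) (b δ)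
      ((fun γ : HexDomainSAW D.carrier δ (a δ) (b δ) => γ.curve) ⁻¹' U) ≤ ENNReal.ofReal η
  rw [← ofReal_measureReal (measure_ne_top _ _)]
  exact ENNReal.ofReal_le_ofReal (h1.trans hδ.le)

/-- **W6 at item level: `HexConjecture → UIM`**, for every Dobrushin domain and endpoint
approximation (`κ = 8/3 ≤ 4`). [folklore] -/
theorem uniformModulus_of_hexConjecture (h : SAWDevelopingMap.HexConjecture)
    (D : DobrushinDomain) (a b : ℝ → HexVertex) (hab : IsEmbEndpointApprox hexGraph hexCenter D a b)
    {ε η : ℝ} (hε : 0 < ε) (hη : 0 < η) :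
    ∃ θ : ℝ, 0 < θ ∧ ∀ᶠ δ : ℝ in 𝓝[>] 0,
      hexSAWLaw D.carrier δ (a δ) (b δ) {γ | γ.curve ∉ CurveClass.modulusClass ε θ} ≤
        ENNReal.ofReal η := by
  refine uniformModulus_of_convergesInLawToSLE (κ := (8 : ℝ≥0) / 3) (by positivity) ?_
    (h D a b hab) hε hη
  rw [div_le_iff₀ (by norm_num : (0 : ℝ≥0) < 3)]
  norm_num

/-- **W6, verbatim**: `HexConjecture` implies the first hypothesis of
`FloorRatio.stub_chordalCarrier_ofModulus` (UIM on floor domains with floor endpoints). [folklore] -/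
theorem floorUniformModulus_of_hexConjecture (h : SAWDevelopingMap.HexConjecture) :
    ∀ (D : DobrushinDomain) (ρ : ℝ) (a b : ℝ → HexVertex),
      (0 < ρ ∧ (D.pt 1).im = (D.pt 0).im ∧ D.carrier ⊆ {z : ℂ | (D.pt 0).im < z.im} ∧
      D.carrier ∩ Metric.ball (D.pt 0) ρ = {z : ℂ | (D.pt 0).im < z.im} ∩ Metric.ball (D.pt 0) ρ ∧
      D.carrier ∩ Metric.ball (D.pt 1) ρ = {z : ℂ | (D.pt 1).im < z.im} ∩ Metric.ball (D.pt 1) ρ) →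
      (IsEmbEndpointApprox hexGraph hexCenter D a b ∧ ∀ᶠ δ : ℝ in 𝓝[>] 0,
      (∃ u : HexVertex, hexGraph.Adj (a δ) u ∧ ((δ : ℂ) * hexCenter u).im ≤ (D.pt 0).im) ∧
      (∃ u : HexVertex, hexGraph.Adj (b δ) u ∧ ((δ : ℂ) * hexCenter u).im ≤ (D.pt 1).im)) →
      ∀ ε η : ℝ, 0 < ε → 0 < η → ∃ θ : ℝ, 0 < θ ∧ ∀ᶠ δ : ℝ in 𝓝[>] 0,
        hexSAWLaw D.carrier δ (a δ) (b δ) {γ | γ.curve ∉ CurveClass.modulusClass ε θ} ≤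
          ENNReal.ofReal η :=
  fun D _ a b _ hab _ _ hε hη => uniformModulus_of_hexConjecture h D a b hab.1 hε hη

/-! ### §10.2 The rev-4 antecedent re-audited for the instance freedoms NOT used by T1–T7

The 5420 kill matched two admissible instances with identical LHS and different RHS.  The remaining
freedoms of an instance of `HexObservableLimit` rev 4, beyond the lattice family (§8.3), are the
continuum data `(Φ, L, Lb)`:
* BRANCH of the logarithm: `L ↦ L + 2πik` is again continuous with `exp L = Φ'` and
  `Lb ↦ Lb + 2πik`.  The RHS `c ∫ ψ exp((5/8)(L − Lb))` is INVARIANT (`rhs_integrand_shift`, checked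
  below) — the planners' `− Lb` normalisation is exactly what kills the would-be phase `e^{5πik/4}`.
  Had the RHS been `exp((5/8)L)/exp((5/8)Lb)` with real powers or `(Φ')^{5/8}` with a principal
  branch, this would have been a one-line refutation; as typed it is not.
* DILATION: `Φ ↦ λΦ`, `λ > 0`, is the full automorphism freedom of `(ℍ; ∞, 0)` (maps fixing `0` and
  `∞`); it shifts `L` and `Lb` by `log λ` — invariant by the same lemma.
* MESOSCOPIC FLOOR LIFT (T5 revisited quantitatively): inside `B(pt i, ρ)` the floor row may sit
  `h_δ = o(1)` above the true floor (exhaustion of compacts forces only `δ·m_i(δ) → im(pt i)`), with a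
  step of height `h_δ` at `|x − pt i| = ρ`.  Hadamard's variation of the boundary derivative under a
  normal displacement `ν` that is CONSTANT near `b` is `δ log Φ'(b) = π⁻¹ p.v.∫ (ν(x) − ν(b)) (x − b)⁻² dx
  + O(ν²)`, here `= −π⁻¹ h_δ ∫_{|x−b|>ρ} (x−b)⁻² dx = −2h_δ/(πρ) → 0`: the lifted family has the SAME
  limit `exp((5/8)(L − Lb))`.  Consistent; but a prover of `QCIdentification` must carry this
  `O(h_δ/ρ)` perturbation through (information for item 8298).
* COLLAR DECORATIONS (T3 revisited): outside the two rigid balls `Λ_δ` is free in the `o(1)` collar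
  (fjords, moats with pinholes, dead ends).  Seen from the interior every such family converges to `D`
  in the Carathéodory sense (it is squeezed between `D_{−η(δ)} ∪` the two half-balls and `D`), and the
  boundary derivatives AT THE MARKED POINTS converge too, because the maps extend by Schwarz reflection
  across the rigid flat pieces and the reflected domains converge in kernel: no decoration changes
  `Φ'(z)/Φ'(b)` at leading order.  This is precisely why rev 4 is robust where 5420 was not (there the
  corridor tip WAS the root at every scale).  Kennedy–Lawler's printed conjecture (§10.6) says the
  same: the lattice correction to boundary densities depends only on the local boundary ANGLE, which
  the rigid class freezes at both marked points.
Conclusion of the re-audit: the instance class of rev 4 has no exact-identity lever left; cheap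
refutation of stmt-14003 is closed from this seat (analytic Conjecture-2-strength input needed). -/

/-- §10.2 checked: the RHS integrand of `HexObservableLimit` rev 4 is invariant under a common shift
of `L` and `Lb` (branch change `2πik`, dilation `log λ`). -/
theorem rhs_integrand_shift (L : ℂ → ℂ) (Lb w z : ℂ) :
    Complex.exp ((5 / 8 : ℂ) * ((L z + w) - (Lb + w))) = Complex.exp ((5 / 8 : ℂ) * (L z - Lb)) := by
  congr 1
  ring

/-- §10.2 checked: without the `− Lb` normalisation a branch change `L ↦ L + 2πi` WOULD move the RHS
by the phase `exp((5/8)·2πi) ≠ 1` — so the normalisation is load-bearing for the TRUTH of the typed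
antecedent, and it is present. -/
theorem branch_phase_ne_one : Complex.exp ((5 / 8 : ℂ) * (2 * Real.pi * Complex.I)) ≠ 1 := by
  intro h
  obtain ⟨n, hn⟩ := Complex.exp_eq_one_iff.1 h
  have hπ : (2 * Real.pi * Complex.I : ℂ) ≠ 0 := by
    simp [Real.pi_ne_zero, Complex.I_ne_zero]
  have h58 : (5 / 8 : ℂ) = n := mul_right_cancel₀ hπ hn
  have hre := congrArg Complex.re h58
  simp only [Complex.intCast_re] at hre
  norm_num at hre
  have h8 : (5 : ℝ) = 8 * n := by linarith
  have h8' : (5 : ℤ) = 8 * n := by exact_mod_cast h8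
  omega

/-! ### §10.3 Deep starts versus the radial restriction exponents (consistency check, no lever)

W2(a) (`exists_isEmbEndpointApprox_deep`) admits sources `δ^{1/2}` deep.  Could the CONCLUSION be false
there — the SAW from a deep point near `a` converging to something other than chordal SLE(8/3) from
`a`?  Reversing the walk (the `x_c^{ℓ}` measure is reversible), the SAW from `b` to an interior point
`z` should converge to the reversal of RADIAL SLE(8/3), whose restriction law is
`P(avoid A) = |Φ_A'(z)|^{5/48} Φ_A'(b)^{5/8}` with `Φ_A` normalised to fix `z` and `b` (LSW / Wu).  The
interior exponent `5/48 ≠ 5/8` looks like a discrepancy as `z → a ∈ ∂D`, but it is not: in `(ℍ; 0, ∞)`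
with `z = iy → ∞ = a`, the map fixing `0` and `iy` is `M_y ∘ g` with `g` the chordal map
(`g(0) = 0`, `g(w)/w → 1`) and `M_y → id`, so `|Φ'(iy)|^{5/48} → 1` and `Φ'(0)^{5/8} → g'(0)^{5/8}` —
the chordal formula.  In general the limit of "fix the interior point `z → a`" is the chordal
normalisation `Φ'(a) = 1`, under which the symmetric chordal law `(Φ'(a)Φ'(b))^{5/8}` reads
`Φ'(b)^{5/8}`.  So radial SLE(8/3) aimed at `z → a` converges to chordal SLE(8/3) at the level of
restriction laws, deep starts are consistent with the typed conclusion, and W2(a) remains an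
obstruction to PROOF (no hypothesis instance speaks about deep starts), not to truth. -/

/-! ### §10.4 The anchor is NOT implied by Conj. 1 on bounded domains (why no necessity theorem W7)

For `ShortChordLocality` ≡ half-plane arch tightness `sup_n f(K,n) → 0` (§8.1(ii), §9.4) one might
hope for a necessity theorem like W5/W6.  The natural comparison with the half-disc domains
`(B(Rn) ∩ ℍ; 0, n)` (Dobrushin domains, where Conj. 1 applies at mesh `1/n`) gives only
`f(K,n) ≤ f_R(K,n) + f(R,n)` (split the half-plane arch mass at the exit of `B(Rn)`; `f_R → g_R(K)`
by Conj. 1 and portmanteau, `g_R(K) → ε_SLE(K)` as `R → ∞`), i.e. for `Λ(K) := limsup_n f(K,n)`: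
`Λ(K) ≤ g_R(K) + Λ(R)`.  This system is solved by EVERY constant `Λ ≡ Λ∞ ∈ [0,1]`
(`anchor_bound_uninformative`): an "escape to infinity" of a fixed fraction `Λ∞` of the `x_c`-mass of
span-`n` arches (excursions to distance `≫ n`) is invisible to all bounded-domain laws.  Hence the
anchor is GENUINELY EXTRA relative to `HexConjecture` (consistent with §6), no `W7` exists, and a
disproof of the anchor would NOT contradict Conj. 1 — it is the one place where this seat could in
principle still score without refuting DCS; but no finite computation or printed estimate bears on
`Λ∞` (the half-plane arch two-point function `a_n ≍ n^{-5/4}` is itself conjectural). -/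

/-- §10.4 checked: the only inequality relating the anchor to bounded-domain limits,
`Λ K ≤ g R K + Λ R` with `g ≥ 0`, is satisfied by every constant `Λ` — it carries no information
about `lim_K Λ K`. -/
theorem anchor_bound_uninformative (c : ℝ) (g : ℝ → ℝ → ℝ) (hg : ∀ R K, 0 ≤ g R K) :
    ∀ R K : ℝ, (fun _ : ℝ => c) K ≤ g R K + (fun _ : ℝ => c) R := by
  intro R K
  have := hg R K
  simp only
  linarith

/-! ### §10.5 `NoRetrace` (sibling typing) is necessary too (checked in `Negative.ModulusNecessity`)

`NoRetrace` (vertex form, the hypothesis of `FloorRatio.stub_chordalCarrier_noRetrace`: no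
`i ≤ j ≤ k ≤ length` with `|δv_i − δv_k| ≤ r`, `|δv_i − δv_j| ≥ ε`) implies UIM (line,
`uniformModulus_of_noRetrace`) AND is implied by Conj. 1: vertex `k` of the walk is the rescaled
polyline at the dyadic time `1 − 2^{-k}` (`polyline_cons_apply_prefixTime`, from the tree's
`polyline_cons_append_apply_prefixTime`), these times are monotone (`prefixTime_mono`), so the vertex
event lies in `(modulusClass (ε/2) θ)ᶜ` with `r := θ/2` (`not_mem_modulusClass_of_vertexReturn`), so
UIM ⇒ `NoRetrace` ALREADY AT THE LATTICE LEVEL, mesh by mesh (`noRetrace_of_uniformModulus`) — the two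
typings are EQUIVALENT up to constants — and W6 applies: `noRetrace_of_convergesInLawToSLE`,
`noRetrace_of_hexConjecture` (verbatim hypothesis; rc 0, axioms standard; part of the pending
`Negative.ModulusNecessity` proposal, not copied here).  Degenerate audit of the vertex event: `i = j`
forces `ε ≤ 0`, `j = k` forces `ε ≤ r` — no junk inhabitants for `r < ε`; it is a genuine
near-return event.  So BOTH typings of the range → curve input are sound and Conj.1-locked, and a
worker may prove whichever is lattice-friendlier. -/

/-! ### §10.6 Printed record consulted this cycle (why the CONCLUSION resists; lattice effects)

* Kennedy, J. Stat. Phys. 114 (2004) [arXiv:math/0207231], read at page level: pivot-algorithm SAW in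
  the half-plane and cut-plane versus the exact SLE(8/3) laws (Schramm's left-passage
  `p(θ) = (1 − cos θ)/2`, LSW hitting densities): "one cannot see any difference … The maximum
  difference of the SAW and SLE(8/3) distributions is only about 0.05%" (p. 7 of the arXiv text), and
  conformal invariance tested through `z ↦ √z` from the cut-plane.  These are RESTRICTION-type
  observables — exactly the data the picked line transports (`FloorRestrictionLimit`,
  `Φ_A'(0)^{5/8}`); numerically the conclusion of the crux is among the best-tested conjectures of the
  field, which is why this seat does not expect `¬HexConjecture` from analysis either.
* Kennedy–Lawler, "Lattice effects in the scaling limit of the two-dimensional SAW", Contemp. Math.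
  601 (2013) [arXiv:1109.3091], read at page level (pp. 3–5): boundary densities of SAW ensembles carry
  a lattice correction `l(θ(z, D))` that PERSISTS in the scaling limit; "our conjecture is that the
  correction only depends on the angle of the boundary"; for `ℤ²` domains with horizontal/vertical
  sides `l` is constant (LSW's original conjecture).  For the crux: (i) the 5420 refutation was a
  lattice effect of a different kind (an all-scale corridor tip as root), now excluded; (ii) rev 4
  freezes the boundary angle AND the local lattice structure at both marked points, so `l` is one
  constant absorbed in the universal `c` — consistent; (iii) every stub comparing UN-normalised
  partition functions at boundary points of DIFFERENT local geometry would be false by Kennedy–Lawler;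
  the picked line compares only floor points (`TargetTransport`, `RestrictionCocycle`: same angle, same
  structure) — consistent.  Planners typing new two-point boundary statements should keep this rule.
* Gwynne–Miller, Ann. Sci. ÉNS (2021) [arXiv:1608.00956], abstract read: the SAW on a random
  quadrangulation converges to SLE(8/3) on √(8/3)-Liouville quantum gravity (via the metric gluing of
  two Brownian half-planes) — the random-geometry analogue of DCS Conjecture 1 is a THEOREM, with the
  exponents KPZ-dual to `5/8`, `5/48`; more indirect evidence that the typed conclusion is right and
  that only the Euclidean-lattice TOOLS are missing.
* Search-degraded note: `lit search` (searchd) answered rc 75 throughout this cycle and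
  `lit galaxy search` returned no relevant rows for "self-avoiding walk SLE 8/3" / Kennedy; the two
  papers above were fetched by arXiv id.  No printed negative result on DCS Conjecture 2 / the
  parafermionic observable's scaling limit is known to this seat (unchanged since cycle 3).

### §10.7 Status for the lead (cycle 6)

Targets: `stuck_stubs = []`; 0 of 7 registered stubs broken after four audits; landed since cycle 5:
stub 5 modulo UIM (+ `NoRetrace ⇒ UIM`), helpers for stubs 3, 4, 6.  New classification: UIM is
Conj.1-implied (W6) — sound, not independently refutable, open-problem strength on the lattice
(§9.1 (5c)).  Unchanged recommendations: the anchor (stub 2) is the only genuinely extra estimate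
(§10.4) and the right place for a dedicated worker with the SLE target `ε_SLE(K) = 1 − (1 − K⁻²)^{5/8}`
(§8.2); `stub_domainExtension` ≡ the crux off the floor class (`extension_iff_crux_of_floor`) — promote
unless a boundary-perturbation mechanism is named; deep starts (§10.3) and non-flat marks
(`RootSilence`) are what it must cover. -/

/-! ## §7 Near-misses: none (cycle 6: the set-level LSW uniqueness of §9.1 (5b) and the half-disc mesh
engine of §8.1 are GAPS for workers, not near-misses of a disproof; the ordered-vertex-times lemma of
§10.5 is done). -/

end Summit.CriticalPhenomena.SAWScalingLimit.Cruxes.ObservableToSLE.Disproof
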